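import Literature.Analysis.FluidPDE.ForwardDSSMollifiedSchemeEnergy
import Literature.Analysis.FluidPDE.ForwardDSSLocalEnergyCubic
import Literature.Analysis.FluidPDE.SlicedLocalEnergy
import HarnessLib

/-!
# Forward DSS solutions: the local energy inequality (3.7) of a mollified approximant
  from the initial time, and the finiteness of its dissipation

Analysis/FluidPDE proof file (theorems only) under the named fact
`Literature.Analysis.FluidPDE.bradshawTsai2019_apriori_3_12` (`ForwardDSSMollifiedScheme.lean`:
the a priori estimate (3.12) of Bradshaw–Tsai, Analysis & PDE 12 (2019) = arXiv:1801.08060,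
§3, pp. 8–10, for every member of the class `BradshawTsai2019.IsMollifiedApproximant`). Second
file of the assembly of (3.12) by the `apriori_3_12` seat (first: `ForwardDSSPressureFormula`,
the pressure formula (3.8) as a named fact with the `L²` classes of `G`, `π_ε` down to `t = 0`).

The printed proof of (3.12) starts from the local energy equality

> (3.7) `∫|v_ε|²φ(t) dx + 2∫₀ᵗ∫|∇v_ε|²φ dx ds = ∫|v₀|²φ dx + ∫₀ᵗ∫|v_ε|²(∂ₛφ + Δφ) dx ds
>  + ∫₀ᵗ∫|v_ε|²((η_{ε√s} * v_ε)·∇φ) dx ds + ∫₀ᵗ∫ 2π_ε(v_ε·∇φ) dx ds`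
> "for any non-negative `φ ∈ C₀^∞(ℝ³ × [0,∞))`. Fix `χ` … `φ(x,t) = χ²(|x|)χ(t)`. We will
> estimate the terms on the right hand side of (3.7) for `0 < t ≤ 1`, and we can treat `φ` as
> `t`-independent from now on." (p. 8)

and every term on its right is then bounded through its modulus (pp. 9–10). The accepted
`IsMollifiedApproximant.local_energy_eq` (`ForwardDSSMollifiedSchemeEnergy`) is (3.7) in
`𝒟'((0,∞) × ℝ³)`, i.e. for test functions compactly supported in the *open* slab. This file
derives from it what the assembly of (3.12) consumes, for a time-independent weight
`ψ ∈ C_c^∞(ℝ³)`, `ψ ≥ 0`, in the `ℝ≥0∞` bookkeeping of the sibling files: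

* `IsMollifiedApproximant.energy_ineq_Ioo` — **(3.7) sliced between two positive times**
  `0 < t₁ < t₂`, with moduli on the right:
  `∫|v_ε(t₂)|²ψ + 2∫_{t₁}^{t₂}∫ψ|∇v_ε|² ≤ ∫|v_ε(t₁)|²ψ + ∫₀^{t₂}∫(|v_ε|²|Δψ| + |v_ε|²|b||∇ψ| + 2|π_ε||v_ε||∇ψ|)`,
  `b = η_{ε√s} * v_ε`. Proof: test the distributional identity with `θ(s)ψ(x)`, `θ` a smooth
  plateau cut-off whose derivative is the difference `k_a − k_b` of two unit-mass kernels
  concentrating at `t₁⁻`, `t₂⁻` (`exists_plateau_cutoff`, from the tree's `exists_time_cutoff`);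
  the `∂ₛφ`-term is `∫k_aA − ∫k_bA` with `A(s) = ∫|v_ε(s)|²ψ` continuous on `(0,∞)`
  (`continuousOn_integral_sq_mul`), and tends to `A(t₁) − A(t₂)`
  (`tendsto_integral_kernel_mul_of_continuousOn`); the dissipation decreases when restricted to
  the plateau, the other terms are bounded by their moduli, which are finite on
  `(t₁/2, t₂) × supp ψ` (continuity of `v_ε`, `b`; local integrability of `π_ε`).
* `IsMollifiedApproximant.energy_ineq_zero` — **(3.7) from the initial time**: the same with
  `t₁ = 0` and `∫|v₀|²ψ` on the right, for an a.e.-strongly measurable datum with `∫|v₀|²ψ < ∞`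
  (`t₁ → 0⁺` through the field `initial` of the class — "`v_ε(t) → v₀` in `L²_loc`", p. 8 — in
  the weighted form `tendsto_lintegral_sq_mul_of_initial`, and monotone convergence of the
  dissipation).
* `IsMollifiedApproximant.supBallEnergy_lt_top` — `α̃_ε(s) < ∞` for `s > 0` when
  `∫_{B₁}|v₀|² < ∞` (continuity of `α_ε` and its right limit at `0`, accepted
  `continuousOn_ballEnergy`, `tendsto_ballEnergy`).
* `IsMollifiedApproximant.lintegral_energyRHS_lt_top`, `…lintegral_dissipation_lt_top` —
  **finiteness down to `t = 0`**: if the classes `G ∈ L²((0,t) × ℝ³)`, `π_ε ∈ L²((0,t) × ℝ³)`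
  hold down to `t = 0` (for the abstract class: accepted `lintegral_drift_sq_Ioo_zero_lt_top`,
  and `lintegral_pressure_sq_Ioo_zero_lt_top` under (3.8), `ForwardDSSPressureFormula`), then the
  right-hand side of (3.7) is finite (`∫₀ᵗ∫_{B_{λᵐ}}|v_ε|² ≤ λ^{3m}tα̃_ε(t)` by the scaling law
  (3.6), accepted `setLIntegral_cylinder_enorm_sq_le_of_dss`; Cauchy–Schwarz for the other two
  terms), hence so is `∫₀ᵗ∫ψ|∇v_ε|²` — the a priori finiteness that the absorption step of
  (3.12) ("the gradient term can be absorbed into the left hand side of (3.7)", p. 9)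
  presupposes and that the printed "(3.7) … for any non-negative `φ`" asserts for the [BT1]
  approximants. The two `L²` hypotheses are kept explicit so that this file does not depend on
  the pending fact file; the assembly feeds them.

No definitions, no notation (statements are written over `EuclideanSpace ℝ (Fin 3)`).

## Mathlib / tree search

Reused: `IsMollifiedApproximant.local_energy_eq`, `continuousOn_mollifiedDrift`,
`continuous_slice`, `continuousOn_ballEnergy`, `tendsto_ballEnergy`, `sqrt_lintegral_sq_le_add`,
`slab_integrable_of_continuousOn` (`ForwardDSSMollifiedScheme(Energy)`); `exists_time_cutoff`
(`SlicedLocalEnergy`; its Lebesgue-point lemma `tendsto_integral_kernel_mul_of_lebesguePoint`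
needs global integrability, whence the continuity variant here); `aestronglyMeasurable_restrict_of_continuousOn`,
`setLIntegral_cylinder_enorm_sq_le_of_dss`, `supBallEnergy_mono` (`ForwardDSSLocalEnergy*`);
`continuous_laplacian`, `continuous_gradient_of_contDiff`, `laplacian_eq_zero_of_notMem_tsupport`,
`gradient_eq_zero_of_notMem_tsupport` (`WholeSpaceIBP`); Mathlib's `continuousAt_of_dominated`,
`setLIntegral_iUnion_of_directed`, `tendsto_atTop_iSup`, `ENNReal.lintegral_mul_le_Lp_mul_Lq`,
`InnerProductSpace.laplacian_smul`, `IsCompact.exists_isMaxOn`.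
`lean search 'energy_ineq_Ioo|energy_ineq_zero|plateau_cutoff'`: nothing prior.

## References

* Z. Bradshaw, T.-P. Tsai, *Discretely self-similar solutions to the Navier–Stokes equations with
  data in `L²_loc` satisfying the local energy inequality*, Analysis & PDE 12 (2019) 1943–1962 =
  arXiv:1801.08060, §3, proof of Prop. 3.1: (3.6), (3.7) and the surrounding text (p. 8), the
  absorption remark (p. 9), the classes of `G`, `π_ε` (p. 9) [BradshawTsai2019].
* L. Caffarelli, R. Kohn, L. Nirenberg, Comm. Pure Appl. Math. 35 (1982), §2, (2.5) (sliced
  local energy inequality via time cut-offs) [CaffarelliKohnNirenberg1982].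
-/

noncomputable section

open MeasureTheory Set Function Filter Topology TopologicalSpace Metric Module
open scoped NNReal ENNReal RealInnerProductSpace ContDiff Laplacian

namespace Literature.Analysis.FluidPDE

namespace BradshawTsai2019

/-! ## Concentrating kernels against a continuous function -/

/-- **Unit-mass kernels concentrating to the left of a continuity point.** If `U` is continuous
on an open set `V ∋ s` and `kₙ` are continuous kernels with `∫kₙ = 1`, `|kₙ| ≤ C/εₙ`, supported
in `[s − 2εₙ, s − εₙ/2]`, `εₙ → 0⁺`, then `∫ kₙ U → U(s)` (`|∫kₙ(U − U(s))| ≤ (3C/2) osc`). The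
Lebesgue-point version is the tree's `tendsto_integral_kernel_mul_of_lebesguePoint`
(`SlicedLocalEnergy`); here continuity replaces the Lebesgue-point hypothesis and no global
integrability of `U` is needed. [folklore] -/
theorem tendsto_integral_kernel_mul_of_continuousOn {U : ℝ → ℝ} {V : Set ℝ} (hV : IsOpen V)
    (hU : ContinuousOn U V) {s : ℝ} (hs : s ∈ V) {C : ℝ} {ε : ℕ → ℝ} (hε : ∀ n, 0 < ε n)
    (hε0 : Tendsto ε atTop (𝓝 0)) {k : ℕ → ℝ → ℝ} (hkc : ∀ n, Continuous (k n))
    (hkb : ∀ n t, |k n t| ≤ C / ε n)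
    (hks : ∀ n t, k n t ≠ 0 → t ∈ Icc (s - 2 * ε n) (s - ε n / 2)) (hk1 : ∀ n, ∫ t, k n t = 1) :
    Tendsto (fun n => ∫ t, k n t * U t) atTop (𝓝 (U s)) := by
  have hC : 0 ≤ C := by
    have h := (abs_nonneg _).trans (hkb 0 s)
    exact (div_nonneg_iff.1 h).elim (fun h => h.1) fun h => absurd (hε 0) (not_lt.2 h.2)
  rw [Metric.tendsto_atTop]
  intro e he
  -- continuity of `U` at `s` inside `V`
  set e' : ℝ := e / (3 * C / 2 + 1) with he'
  have he'0 : 0 < e' := div_pos he (by positivity)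
  have hUs : ContinuousAt U s := hU.continuousAt (hV.mem_nhds hs)
  obtain ⟨δ, hδ0, hδ⟩ : ∃ δ > 0, ∀ t, dist t s < δ → t ∈ V ∧ dist (U t) (U s) < e' := by
    have h1 : ∀ᶠ t in 𝓝 s, t ∈ V := hV.mem_nhds hs
    have h2 : ∀ᶠ t in 𝓝 s, dist (U t) (U s) < e' := hUs (ball_mem_nhds _ he'0)
    obtain ⟨δ, hδ0, hδ⟩ := Metric.eventually_nhds_iff.1 (h1.and h2)
    exact ⟨δ, hδ0, fun t ht => hδ ht⟩
  obtain ⟨N, hN⟩ : ∃ N, ∀ n ≥ N, ε n < δ / 2 := by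
    have := hε0.eventually (gt_mem_nhds (half_pos hδ0))
    exact eventually_atTop.1 this
  refine ⟨N, fun n hn => ?_⟩
  have hεn := hε n
  have hIδ : ∀ t ∈ Icc (s - 2 * ε n) (s - ε n / 2), dist t s < δ := fun t ht => by
    rw [Real.dist_eq, abs_lt]
    constructor <;> linarith [ht.1, ht.2, hN n hn]
  -- everything happens on the interval `I = [s − 2εₙ, s − εₙ/2]`
  set I : Set ℝ := Icc (s - 2 * ε n) (s - ε n / 2) with hI
  have hIm : MeasurableSet I := measurableSet_Icc
  have hIvol : volume I = ENNReal.ofReal (3 * ε n / 2) := by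
    rw [hI, Real.volume_Icc]; congr 1; ring
  have hk0 : ∀ t ∉ I, k n t = 0 := fun t ht => by_contra fun h => ht (hks n t h)
  have hUI : AEStronglyMeasurable U (volume.restrict I) :=
    (hU.mono fun t ht => (hδ t (hIδ t ht)).1).aestronglyMeasurable hIm
  have hbdd : ∀ t ∈ I, ‖k n t * (U t - U s)‖ ≤ C / ε n * e' := fun t ht => by
    rw [norm_mul, Real.norm_eq_abs, Real.norm_eq_abs]
    exact mul_le_mul (hkb n t) (le_of_lt (by simpa [Real.dist_eq] using (hδ t (hIδ t ht)).2))
      (abs_nonneg _) (div_nonneg hC hεn.le)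
  -- `∫ kₙ U − U(s) = ∫_I kₙ (U − U(s))`
  have hkI : Integrable (k n) volume :=
    (hkc n).integrable_of_hasCompactSupport (HasCompactSupport.intro isCompact_Icc hk0)
  have hprodI : IntegrableOn (fun t => k n t * (U t - U s)) I volume := by
    refine Integrable.mono' (g := fun _ => C / ε n * e') (integrableOn_const ?_) ?_ ?_
    · rw [hIvol]; exact ENNReal.ofReal_ne_top
    · exact ((hkc n).aestronglyMeasurable.restrict.mul (hUI.sub aestronglyMeasurable_const))
    · exact (ae_restrict_iff' hIm).2 (ae_of_all _ hbdd)
  have hprod : Integrable (fun t => k n t * (U t - U s)) volume := by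
    refine (integrableOn_iff_integrable_of_support_subset (s := I) fun t ht => ?_).1 hprodI
    by_contra h
    exact ht (by simp [hk0 t h])
  have hsplit : ∫ t, k n t * U t = (∫ t, k n t * (U t - U s)) + U s := by
    have e1 : ∀ t, k n t * U t = k n t * (U t - U s) + k n t * U s := fun t => by ring
    simp_rw [e1]
    rw [integral_add hprod (hkI.mul_const _), integral_mul_const, hk1 n, one_mul]
  rw [hsplit, dist_eq_norm, add_sub_cancel_right,
    ← setIntegral_eq_integral_of_forall_compl_eq_zero (s := I) (fun t ht => by simp [hk0 t ht])]
  calc ‖∫ t in I, k n t * (U t - U s)‖ ≤ C / ε n * e' * (volume I).toReal :=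
        norm_setIntegral_le_of_norm_le_const (by rw [hIvol]; exact ENNReal.ofReal_lt_top) hbdd
    _ = 3 * C / 2 * e' := by
        rw [hIvol, ENNReal.toReal_ofReal (by positivity)]
        field_simp
    _ < e := by
        rw [he', ← mul_div_assoc, div_lt_iff₀ (by positivity)]
        nlinarith

/-! ## Plateau cut-offs in time with derivative `k_a − k_b` -/

/-- **Smooth plateau cut-offs in time.** There is an absolute constant `C ≥ 0` such that for
`t₁ < t₂` and `0 < ε` with `3ε < t₂ − t₁` there are smooth `θ, k_a, k_b : ℝ → ℝ` with
`0 ≤ θ ≤ 1`, `θ = 1` on `[t₁ − ε/2, t₂ − 2ε]`, `θ = 0` on `(−∞, t₁ − 2ε] ∪ [t₂ − ε/2, ∞)`,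
`θ' = k_a − k_b`, where `k_a`, `k_b` are continuous unit-mass kernels bounded by `C/ε` and
supported in `[t₁ − 2ε, t₁ − ε/2]`, `[t₂ − 2ε, t₂ − ε/2]` (`θ = (1 − η_a)η_b` with the one-sided
cut-offs of the tree's `exists_time_cutoff`). [folklore] -/
theorem exists_plateau_cutoff :
    ∃ C : ℝ, 0 ≤ C ∧ ∀ t₁ t₂ ε : ℝ, 0 < ε → 3 * ε < t₂ - t₁ → ∃ θ ka kb : ℝ → ℝ,
      ContDiff ℝ (⊤ : ℕ∞) θ ∧ (∀ t, 0 ≤ θ t ∧ θ t ≤ 1) ∧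
      (∀ t, t ∈ Icc (t₁ - ε / 2) (t₂ - 2 * ε) → θ t = 1) ∧
      (∀ t, t ≤ t₁ - 2 * ε → θ t = 0) ∧ (∀ t, t₂ - ε / 2 ≤ t → θ t = 0) ∧
      (∀ t, HasDerivAt θ (ka t - kb t) t) ∧ Continuous ka ∧ Continuous kb ∧
      (∀ t, |ka t| ≤ C / ε) ∧ (∀ t, |kb t| ≤ C / ε) ∧
      (∀ t, ka t ≠ 0 → t ∈ Icc (t₁ - 2 * ε) (t₁ - ε / 2)) ∧
      (∀ t, kb t ≠ 0 → t ∈ Icc (t₂ - 2 * ε) (t₂ - ε / 2)) ∧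
      ∫ t, ka t = 1 ∧ ∫ t, kb t = 1 := by
  obtain ⟨C, hC, hcut⟩ := exists_time_cutoff
  refine ⟨C, hC, fun t₁ t₂ ε hε hsep => ?_⟩
  obtain ⟨ηa, ka, ha_smooth, ha01, ha1, ha0, had, hkac, hkab, hkas, hka1⟩ := hcut t₁ ε hε
  obtain ⟨ηb, kb, hb_smooth, hb01, hb1, hb0, hbd, hkbc, hkbb, hkbs, hkb1⟩ := hcut t₂ ε hε
  refine ⟨fun t => (1 - ηa t) * ηb t, ka, kb, (contDiff_const.sub ha_smooth).mul hb_smooth,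
    fun t => ⟨mul_nonneg (sub_nonneg.2 (ha01 t).2) (hb01 t).1,
      mul_le_one₀ (sub_le_self _ (ha01 t).1) (hb01 t).1 (hb01 t).2⟩,
    fun t ht => ?_, fun t ht => ?_, fun t ht => ?_, fun t => ?_, hkac, hkbc, hkab, hkbb, hkas, hkbs,
    hka1, hkb1⟩
  · show (1 - ηa t) * ηb t = 1
    rw [ha0 t ht.1, hb1 t ht.2]; ring
  · show (1 - ηa t) * ηb t = 0
    rw [ha1 t ht]; ring
  · show (1 - ηa t) * ηb t = 0
    rw [hb0 t ht]; ring
  · have h : HasDerivAt (fun t => (1 - ηa t) * ηb t)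
        ((0 - -ka t) * ηb t + (1 - ηa t) * -kb t) t :=
      ((hasDerivAt_const t (1 : ℝ)).fun_sub (had t)).fun_mul (hbd t)
    refine h.congr_deriv ?_
    -- `k_a η_b + (1 − η_a)(−k_b) = k_a − k_b`: the supports of `k_a`, `k_b` are separated
    by_cases hka : ka t = 0
    · by_cases hkb : kb t = 0
      · rw [hka, hkb]; ring
      · have ht := hkbs t hkb
        have : ηa t = 0 := ha0 t (by linarith [ht.1])
        rw [hka, this]; ring
    · have ht := hkas t hka
      have h1 : ηb t = 1 := hb1 t (by linarith [ht.2])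
      have h2 : kb t = 0 := by
        by_contra h
        have := hkbs t h
        linarith [this.1, ht.2]
      rw [h1, h2]; ring


/-! ## Slice functionals and test fields of product form -/

/-- **Continuity of the weighted local energy** `s ↦ ∫ |w(s,x)|² ψ(x) dx` on `(0, ∞)`, for a field
`w` jointly continuous on the open slab and a continuous compactly supported weight `ψ`
(Bradshaw–Tsai 2019, p. 8: "because each `v_ε` is smooth on `ℝ³ × (0,∞)` … `α_ε(t)` … [is]
continuous"; dominated convergence near each `t₀ > 0`, the field being bounded on
`[t₀/2, 2t₀] × supp ψ`). [cite: BradshawTsai2019, §3 proof of Prop 3.1 (p. 8)] -/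
theorem continuousOn_integral_sq_mul {w : ℝ → (EuclideanSpace ℝ (Fin 3)) → (EuclideanSpace ℝ (Fin 3))}
    (hw : ContinuousOn (uncurry w) (Ioi (0 : ℝ) ×ˢ (univ : Set (EuclideanSpace ℝ (Fin 3))))) {ψ : (EuclideanSpace ℝ (Fin 3)) → ℝ}
    (hψ : Continuous ψ) (hψc : HasCompactSupport ψ) :
    ContinuousOn (fun s => ∫ x, ‖w s x‖ ^ 2 * ψ x) (Ioi 0) := by
  intro t₀ ht₀
  have ht₀' : (0 : ℝ) < t₀ := ht₀
  refine ContinuousAt.continuousWithinAt ?_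
  have hK : IsCompact (Icc (t₀ / 2) (2 * t₀) ×ˢ tsupport ψ) := isCompact_Icc.prod hψc
  have hKsub : Icc (t₀ / 2) (2 * t₀) ×ˢ tsupport ψ ⊆ Ioi (0 : ℝ) ×ˢ (univ : Set (EuclideanSpace ℝ (Fin 3))) :=
    prod_mono (fun t ht => (half_pos ht₀').trans_le ht.1) (subset_univ _)
  obtain ⟨M, hM⟩ := hK.exists_bound_of_continuousOn (hw.mono hKsub)
  have hbox : Icc (t₀ / 2) (2 * t₀) ∈ 𝓝 t₀ := Icc_mem_nhds (by linarith) (by linarith)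
  have hslice : ∀ s, (0 : ℝ) < s → Continuous (w s) := fun s hs =>
    continuous_slice_of_continuousOn hw hs
  refine continuousAt_of_dominated (bound := fun x => M ^ 2 * ‖ψ x‖) ?_ ?_ ?_ ?_
  · filter_upwards [hbox] with s hs
    exact (((hslice s ((half_pos ht₀').trans_le hs.1)).norm.pow 2).mul hψ).aestronglyMeasurable
  · filter_upwards [hbox] with s hs
    refine ae_of_all _ fun x => ?_
    rw [norm_mul, norm_pow, norm_norm]
    by_cases hx : x ∈ tsupport ψ
    · have hb' : ‖w s x‖ ≤ M := hM (s, x) ⟨hs, hx⟩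
      exact mul_le_mul_of_nonneg_right
        (pow_le_pow_left₀ (norm_nonneg _) hb' 2) (norm_nonneg _)
    · simp [image_eq_zero_of_notMem_tsupport hx]
  · exact ((hψ.norm).const_mul _).integrable_of_hasCompactSupport hψc.norm.mul_left
  · refine ae_of_all _ fun x => ?_
    have hca : ContinuousAt (uncurry w) (t₀, x) :=
      hw.continuousAt (prod_mem_nhds (Ioi_mem_nhds ht₀') univ_mem)
    have hline : ContinuousAt (fun s => w s x) t₀ :=
      (hca.comp (f := fun s : ℝ => (s, x)) (continuous_id.prodMk continuous_const).continuousAt : _)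
    exact (hline.norm.pow 2).mul continuousAt_const

/-- A product `θ(t)ψ(x)` of a smooth `θ` vanishing off a compact interval `[a, b] ⊂ (0, ∞)` and a
smooth compactly supported `ψ` is a space–time test function on the open slab `(0,∞) × ℝ³`
(the `U = ℝ³` case of the tree's `isSpaceTimeTestOn_prod_mul`, `LocalLerayInitialEnergy`, not
imported into the DSS chain). [folklore] -/
theorem isSpaceTimeTestOn_slab_mul {θ : ℝ → ℝ} (hθ : ContDiff ℝ (⊤ : ℕ∞) θ) {a b : ℝ}
    (ha : 0 < a) (hθ0 : ∀ t, t ∉ Icc a b → θ t = 0) {ψ : (EuclideanSpace ℝ (Fin 3)) → ℝ} (hψ : ContDiff ℝ (⊤ : ℕ∞) ψ)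
    (hψc : HasCompactSupport ψ) :
    IsSpaceTimeTestOn (slab (EuclideanSpace ℝ (Fin 3)) (Ioi 0) isOpen_Ioi) (fun t x => θ t * ψ x) := by
  have hK : IsCompact (Icc a b ×ˢ tsupport ψ) := isCompact_Icc.prod hψc
  have hzero : ∀ z : ℝ × (EuclideanSpace ℝ (Fin 3)), z ∉ Icc a b ×ˢ tsupport ψ →
      uncurry (fun t x => θ t * ψ x) z = 0 := by
    rintro ⟨t, x⟩ hz
    rcases not_and_or.1 (fun h => hz (mem_prod.2 h)) with h | h
    · simp [uncurry, hθ0 t h]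
    · simp [uncurry, image_eq_zero_of_notMem_tsupport h]
  have hts : tsupport (uncurry fun t x => θ t * ψ x) ⊆ Icc a b ×ˢ tsupport ψ :=
    closure_minimal (fun z hz => by_contra fun h' => hz (hzero z h'))
      (isClosed_Icc.prod (isClosed_tsupport ψ))
  exact
    { contDiff := (hθ.comp contDiff_fst).mul (hψ.comp contDiff_snd)
      hasCompactSupport := HasCompactSupport.intro hK hzero
      tsupport_subset := hts.trans (by
        rw [coe_slab]
        exact prod_mono (fun t ht => ha.trans_le ht.1) (subset_univ _)) }

/-- `∇(a ψ) = a ∇ψ` for a differentiable `ψ` (the tree's `gradient_fun_const_smul`,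
`SuitableWeakSliced`, which is not imported here). [folklore] -/
theorem gradient_const_mul' {ψ : (EuclideanSpace ℝ (Fin 3)) → ℝ} {x : (EuclideanSpace ℝ (Fin 3))} (hψ : DifferentiableAt ℝ ψ x) (a : ℝ) :
    gradient (fun y => a * ψ y) x = a • gradient ψ x := by
  have : (fun y => a * ψ y) = fun y => a • ψ y := rfl
  rw [this]
  simp only [gradient, fderiv_fun_const_smul hψ, map_smulₛₗ, starRingEnd_apply, star_trivial]

/-! ## The local energy inequality of a member between two positive times -/

section Members

variable {c ε : ℝ} {η : (EuclideanSpace ℝ (Fin 3)) → ℝ} {v₀ : (EuclideanSpace ℝ (Fin 3)) → (EuclideanSpace ℝ (Fin 3))} {w : ℝ → (EuclideanSpace ℝ (Fin 3)) → (EuclideanSpace ℝ (Fin 3))} {ϖ : ℝ → (EuclideanSpace ℝ (Fin 3)) → ℝ}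

/-- **The local energy inequality of a mollified approximant between two positive times**
(the sliced form of (3.7) of Bradshaw–Tsai 2019, p. 8, for a time-independent weight
`ψ ∈ C_c^∞(ℝ³)`, `ψ ≥ 0` — "we can treat `φ` as `t`-independent from now on" — with moduli on
the right): for a member `(v_ε, π_ε)` of the class and `0 < t₁ < t₂`,
`∫|v_ε(t₂)|²ψ + 2∫_{t₁}^{t₂}∫ψ|∇v_ε|² ≤ ∫|v_ε(t₁)|²ψ + ∫₀^{t₂}∫(|v_ε|²|Δψ| + |v_ε|²|b||∇ψ| + 2|π_ε||v_ε||∇ψ|)`,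
`b = η_{ε√s} * v_ε`, in `ℝ≥0∞`. Proof: test the accepted distributional identity
`IsMollifiedApproximant.local_energy_eq` with `θ(s)ψ(x)`, `θ` a smooth plateau cut-off equal to
`1` on `[t₁ − ε'/2, t₂ − 2ε']` whose derivative is the difference `k_a − k_b` of two unit-mass
kernels concentrating at `t₁⁻` and `t₂⁻` (`exists_plateau_cutoff`); the `∂ₛφ` term is
`∫k_a A − ∫k_b A`, `A(s) = ∫|v_ε(s)|²ψ` continuous (`continuousOn_integral_sq_mul`), which tends
to `A(t₁) − A(t₂)` as `ε' → 0` (`tendsto_integral_kernel_mul_of_continuousOn`); the dissipation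
term decreases when restricted to the plateau and the remaining terms are bounded by their moduli
on `(0, t₂)`. [cite: BradshawTsai2019, §3 (3.7) and p. 8] -/
theorem IsMollifiedApproximant.energy_ineq_Ioo (h : IsMollifiedApproximant c ε η v₀ w ϖ)
    (hη : ContDiff ℝ ∞ η) (hηc : HasCompactSupport η) (hε : 0 < ε)
    {ψ : (EuclideanSpace ℝ (Fin 3)) → ℝ} (hψ : ContDiff ℝ ∞ ψ) (hψc : HasCompactSupport ψ) (hψ0 : ∀ x, 0 ≤ ψ x)
    {t₁ t₂ : ℝ} (ht₁ : 0 < t₁) (h12 : t₁ < t₂) :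
    ENNReal.ofReal (∫ x, ‖w t₂ x‖ ^ 2 * ψ x) +
        2 * ∫⁻ z in Ioo t₁ t₂ ×ˢ (univ : Set (EuclideanSpace ℝ (Fin 3))),
          ENNReal.ofReal (ψ z.2 * frobeniusNormSq (fderiv ℝ (w z.1) z.2)) ≤
      ENNReal.ofReal (∫ x, ‖w t₁ x‖ ^ 2 * ψ x) +
        ∫⁻ z in Ioo 0 t₂ ×ˢ (univ : Set (EuclideanSpace ℝ (Fin 3))), (‖w z.1 z.2‖ₑ ^ 2 * ‖(Δ ψ) z.2‖ₑ + ‖w z.1 z.2‖ₑ ^ 2 * ‖mollifiedDrift η ε w z.1 z.2‖ₑ * ‖gradient ψ z.2‖ₑ + 2 * ‖ϖ z.1 z.2‖ₑ * ‖w z.1 z.2‖ₑ * ‖gradient ψ z.2‖ₑ) := by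
  -- ### notation and standing facts
  set Q : Set (ℝ × (EuclideanSpace ℝ (Fin 3))) := Ioi (0 : ℝ) ×ˢ (univ : Set (EuclideanSpace ℝ (Fin 3))) with hQ_def
  have hQopen : IsOpen Q := isOpen_Ioi.prod isOpen_univ
  set A : ℝ → ℝ := fun s => ∫ x, ‖w s x‖ ^ 2 * ψ x with hA_def
  set Gr : ℝ × (EuclideanSpace ℝ (Fin 3)) → ℝ := fun z => ψ z.2 * frobeniusNormSq (fderiv ℝ (w z.1) z.2) with hGr_def
  have hw1 : ContDiffOn ℝ 1 (uncurry w) Q := h.smooth.of_le (by exact_mod_cast le_top)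
  have cw : ContinuousOn (uncurry w) Q := h.smooth.continuousOn
  have cw' : ContinuousOn (fun z : ℝ × (EuclideanSpace ℝ (Fin 3)) => w z.1 z.2) Q := cw
  have cDw : ContinuousOn (fun z : ℝ × (EuclideanSpace ℝ (Fin 3)) => fderiv ℝ (w z.1) z.2) Q :=
    continuousOn_fderiv_slice_of_contDiffOn hw1 isOpen_Ioi.uniqueDiffOn
  have cb : ContinuousOn (uncurry (mollifiedDrift η ε w)) Q :=
    h.continuousOn_mollifiedDrift hη.continuous hηc hε
  have cb' : ContinuousOn (fun z : ℝ × (EuclideanSpace ℝ (Fin 3)) => mollifiedDrift η ε w z.1 z.2) Q := cb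
  have cGr : ContinuousOn Gr Q :=
    (hψ.continuous.comp continuous_snd).continuousOn.mul
      (LerayHopfProofs.continuous_frobeniusNormSq.comp_continuousOn cDw)
  have hGr0 : ∀ z, z ∈ Q → 0 ≤ Gr z := fun z _ =>
    mul_nonneg (hψ0 _) (frobeniusNormSq_nonneg _)
  have hAcont : ContinuousOn A (Ioi 0) := continuousOn_integral_sq_mul cw hψ.continuous hψc
  have hA0 : ∀ s, 0 ≤ A s := fun s => integral_nonneg fun x => mul_nonneg (sq_nonneg _) (hψ0 x)
  have hψ2 : ContDiff ℝ 2 ψ := hψ.of_le (by norm_cast)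
  have hψ1 : ContDiff ℝ 1 ψ := hψ2.of_le one_le_two
  have hψd : ∀ x, DifferentiableAt ℝ ψ x := fun x => hψ2.differentiable (by norm_num) x
  -- ### the vanishing cut-off scales
  set δ₀ : ℝ := min (t₁ / 8) ((t₂ - t₁) / 6) with hδ₀
  have hδ₀pos : 0 < δ₀ := lt_min (by linarith) (by linarith)
  set e : ℕ → ℝ := fun n => δ₀ / (n + 1) with he_def
  have he_pos : ∀ n, 0 < e n := fun n => div_pos hδ₀pos (by positivity)
  have he_le : ∀ n, e n ≤ δ₀ := fun n => div_le_self hδ₀pos.le (by linarith [n.cast_nonneg (α := ℝ)])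
  have he_lim : Tendsto e atTop (𝓝 0) := by
    have := (tendsto_one_div_add_atTop_nhds_zero_nat (𝕜 := ℝ)).const_mul δ₀
    rw [mul_zero] at this
    exact this.congr fun n => by simp only [he_def]; ring
  have he_sep : ∀ n, 3 * e n < t₂ - t₁ := fun n => by
    have : δ₀ ≤ (t₂ - t₁) / 6 := min_le_right _ _
    linarith [he_le n]
  have he_t₁ : ∀ n, t₁ / 2 < t₁ - 2 * e n := fun n => by
    have : δ₀ ≤ t₁ / 8 := min_le_left _ _
    linarith [he_le n]
  -- ### the cut-offs
  obtain ⟨C, hC, hcut⟩ := exists_plateau_cutoff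
  choose θ ka kb hθs hθ01 hθ1 hθa hθb hθd hkac hkbc hkab hkbb hkas hkbs hka1 hkb1 using
    fun n => hcut t₁ t₂ (e n) (he_pos n) (he_sep n)
  -- supports of the cut-offs: `[t₁ − 2eₙ, t₂]`, inside `(t₁/2, ∞)`
  have hθ0 : ∀ n t, t ∉ Icc (t₁ - 2 * e n) t₂ → θ n t = 0 := by
    intro n t ht
    rcases not_and_or.1 (fun h' => ht ⟨h'.1, h'.2⟩) with h' | h'
    · exact hθa n t (not_le.1 h').le
    · exact hθb n t (by linarith [not_le.1 h', he_pos n])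
  have hφtest : ∀ n, IsSpaceTimeTestOn (slab (EuclideanSpace ℝ (Fin 3)) (Ioi 0) isOpen_Ioi) (fun t x => θ n t * ψ x) :=
    fun n => isSpaceTimeTestOn_slab_mul (hθs n) (by linarith [he_t₁ n]) (hθ0 n) hψ hψc
  -- ### the energy identity tested with `θₙ ψ`
  have hderivθ : ∀ n t, deriv (θ n) t = ka n t - kb n t := fun n t => (hθd n t).deriv
  have key : ∀ n,
      2 * ∫ z in Q, θ n z.1 * Gr z =
        (∫ z in Q, ‖w z.1 z.2‖ ^ 2 * ((ka n z.1 - kb n z.1) * ψ z.2 + θ n z.1 * (Δ ψ) z.2)) +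
          (∫ z in Q, ‖w z.1 z.2‖ ^ 2 * (θ n z.1 * ⟪mollifiedDrift η ε w z.1 z.2, gradient ψ z.2⟫)) +
          ∫ z in Q, 2 * ϖ z.1 z.2 * (θ n z.1 * ⟪w z.1 z.2, gradient ψ z.2⟫) := by
    intro n
    have E := h.local_energy_eq hη hηc hε (hφtest n)
    have e1 : ∀ z : ℝ × (EuclideanSpace ℝ (Fin 3)), (fun t x => θ n t * ψ x) z.1 z.2 * frobeniusNormSq (fderiv ℝ (w z.1) z.2) =
        θ n z.1 * Gr z := fun z => by simp only [hGr_def]; ring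
    have e2 : ∀ z : ℝ × (EuclideanSpace ℝ (Fin 3)), timeDeriv (fun t x => θ n t * ψ x) z.1 z.2 +
        (Δ (fun x => θ n z.1 * ψ x)) z.2 = (ka n z.1 - kb n z.1) * ψ z.2 + θ n z.1 * (Δ ψ) z.2 := by
      intro z
      have hd : timeDeriv (fun t x => θ n t * ψ x) z.1 z.2 = (ka n z.1 - kb n z.1) * ψ z.2 := by
        rw [timeDeriv_apply]
        exact ((hθd n z.1).mul_const (ψ z.2)).deriv
      have hl : (Δ (fun x => θ n z.1 * ψ x)) z.2 = θ n z.1 * (Δ ψ) z.2 := by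
        have hfun : (fun x => θ n z.1 * ψ x) = (θ n z.1) • ψ := by
          funext x; simp [smul_eq_mul]
        rw [hfun, InnerProductSpace.laplacian_smul (θ n z.1) hψ2.contDiffAt, smul_eq_mul]
      rw [hd, hl]
    have e3 : ∀ z : ℝ × (EuclideanSpace ℝ (Fin 3)), gradient (fun x => θ n z.1 * ψ x) z.2 = θ n z.1 • gradient ψ z.2 :=
      fun z => gradient_const_mul' (hψd z.2) (θ n z.1)
    simp only [e1] at E
    rw [E]
    congr 1
    · congr 1
      · exact integral_congr_ae (ae_of_all _ fun z => by simp only [e2])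
      · refine integral_congr_ae (ae_of_all _ fun z => ?_)
        simp only [e3, real_inner_smul_right]
    · refine integral_congr_ae (ae_of_all _ fun z => ?_)
      simp only [e3, real_inner_smul_right]
  -- ### compact boxes inside the slab
  have hbox : ∀ {a b' : ℝ}, 0 < a → IsCompact (Icc a b' ×ˢ tsupport ψ) ∧
      Icc a b' ×ˢ tsupport ψ ⊆ Q := fun ha =>
    ⟨isCompact_Icc.prod hψc, prod_mono (fun t ht => ha.trans_le ht.1) (subset_univ _)⟩
  -- the kernels vanish off `[t₁ − 2eₙ, t₂]`
  have hka0 : ∀ n t, t ∉ Icc (t₁ - 2 * e n) t₂ → ka n t = 0 := by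
    intro n t ht
    by_contra h'
    have := hkas n t h'
    exact ht ⟨this.1, by linarith [this.2, he_pos n]⟩
  have hkb0 : ∀ n t, t ∉ Icc (t₁ - 2 * e n) t₂ → kb n t = 0 := by
    intro n t ht
    by_contra h'
    have := hkbs n t h'
    exact ht ⟨by linarith [this.1, he_sep n, he_pos n], by linarith [this.2, he_pos n]⟩
  -- ### Fubini for the `∂ₛφ` terms: `∫∫ |w|² k(s) ψ = ∫ k A`
  have hFub : ∀ n (k : ℝ → ℝ), Continuous k → (∀ t, t ∉ Icc (t₁ - 2 * e n) t₂ → k t = 0) →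
      IntegrableOn (fun z : ℝ × (EuclideanSpace ℝ (Fin 3)) => ‖w z.1 z.2‖ ^ 2 * (k z.1 * ψ z.2)) Q volume ∧
      ∫ z in Q, ‖w z.1 z.2‖ ^ 2 * (k z.1 * ψ z.2) = ∫ s, k s * A s := by
    intro n k hk hk0
    obtain ⟨hK, hKQ⟩ := hbox (b' := t₂) ((half_pos ht₁).trans (he_t₁ n))
    have cF : ContinuousOn (fun z : ℝ × (EuclideanSpace ℝ (Fin 3)) => ‖w z.1 z.2‖ ^ 2 * (k z.1 * ψ z.2)) Q :=
      (cw'.norm.pow 2).mul (((hk.comp continuous_fst).mul (hψ.continuous.comp continuous_snd)).continuousOn)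
    have hF0 : ∀ z, z ∉ Icc (t₁ - 2 * e n) t₂ ×ˢ tsupport ψ →
        (fun z : ℝ × (EuclideanSpace ℝ (Fin 3)) => ‖w z.1 z.2‖ ^ 2 * (k z.1 * ψ z.2)) z = 0 := by
      rintro ⟨t, x⟩ hz
      rcases not_and_or.1 (fun h' => hz (mem_prod.2 h')) with h' | h'
      · simp [hk0 t h']
      · simp [image_eq_zero_of_notMem_tsupport h']
    obtain ⟨-, -, hint, hfub⟩ := slab_integrable_of_continuousOn hK hKQ cF hF0
    refine ⟨hint, ?_⟩
    rw [hfub]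
    refine integral_congr_ae (ae_of_all _ fun s => ?_)
    show ∫ x, ‖w s x‖ ^ 2 * (k s * ψ x) = k s * A s
    simp only [hA_def, ← integral_const_mul]
    exact integral_congr_ae (ae_of_all _ fun x => by ring)
  -- ### the `θ Δψ` term and the dissipation term are integrable on the slab
  have hFθ : ∀ n, IntegrableOn (fun z : ℝ × (EuclideanSpace ℝ (Fin 3)) => ‖w z.1 z.2‖ ^ 2 * (θ n z.1 * (Δ ψ) z.2)) Q volume := by
    intro n
    obtain ⟨hK, hKQ⟩ := hbox (b' := t₂) ((half_pos ht₁).trans (he_t₁ n))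
    have hΔc : Continuous (Δ ψ) := continuous_laplacian hψ2
    have cF : ContinuousOn (fun z : ℝ × (EuclideanSpace ℝ (Fin 3)) => ‖w z.1 z.2‖ ^ 2 * (θ n z.1 * (Δ ψ) z.2)) Q :=
      (cw'.norm.pow 2).mul ((((hθs n).continuous.comp continuous_fst).mul
        (hΔc.comp continuous_snd)).continuousOn)
    have hF0 : ∀ z, z ∉ Icc (t₁ - 2 * e n) t₂ ×ˢ tsupport ψ →
        (fun z : ℝ × (EuclideanSpace ℝ (Fin 3)) => ‖w z.1 z.2‖ ^ 2 * (θ n z.1 * (Δ ψ) z.2)) z = 0 := by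
      rintro ⟨t, x⟩ hz
      rcases not_and_or.1 (fun h' => hz (mem_prod.2 h')) with h' | h'
      · simp [hθ0 n t h']
      · simp [laplacian_eq_zero_of_notMem_tsupport h']
    exact (slab_integrable_of_continuousOn hK hKQ cF hF0).2.2.1
  have hFG : ∀ n, IntegrableOn (fun z : ℝ × (EuclideanSpace ℝ (Fin 3)) => θ n z.1 * Gr z) Q volume := by
    intro n
    obtain ⟨hK, hKQ⟩ := hbox (b' := t₂) ((half_pos ht₁).trans (he_t₁ n))
    have cF : ContinuousOn (fun z : ℝ × (EuclideanSpace ℝ (Fin 3)) => θ n z.1 * Gr z) Q :=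
      (((hθs n).continuous.comp continuous_fst).continuousOn).mul cGr
    have hF0 : ∀ z, z ∉ Icc (t₁ - 2 * e n) t₂ ×ˢ tsupport ψ →
        (fun z : ℝ × (EuclideanSpace ℝ (Fin 3)) => θ n z.1 * Gr z) z = 0 := by
      rintro ⟨t, x⟩ hz
      rcases not_and_or.1 (fun h' => hz (mem_prod.2 h')) with h' | h'
      · simp [hθ0 n t h']
      · simp [hGr_def, image_eq_zero_of_notMem_tsupport h']
    exact (slab_integrable_of_continuousOn hK hKQ cF hF0).2.2.1
  -- ### the finite modulus bound on `(t₁/2, t₂) × ℝ³`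
  set T : Set (ℝ × (EuclideanSpace ℝ (Fin 3))) := Ioo (t₁ / 2) t₂ ×ˢ (univ : Set (EuclideanSpace ℝ (Fin 3))) with hT_def
  have hTm : MeasurableSet T := measurableSet_Ioo.prod MeasurableSet.univ
  have hTQ : T ⊆ Q := prod_mono (fun t ht => (half_pos ht₁).trans ht.1) subset_rfl
  set Rfin : ℝ≥0∞ := ∫⁻ z in T, (‖w z.1 z.2‖ₑ ^ 2 * ‖(Δ ψ) z.2‖ₑ + ‖w z.1 z.2‖ₑ ^ 2 * ‖mollifiedDrift η ε w z.1 z.2‖ₑ * ‖gradient ψ z.2‖ₑ + 2 * ‖ϖ z.1 z.2‖ₑ * ‖w z.1 z.2‖ₑ * ‖gradient ψ z.2‖ₑ) with hRfin_def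
  have hΔ0 : ∀ x, x ∉ tsupport ψ → (Δ ψ) x = 0 := fun x hx => laplacian_eq_zero_of_notMem_tsupport hx
  have hg0 : ∀ x, x ∉ tsupport ψ → gradient ψ x = 0 := fun x hx => gradient_eq_zero_of_notMem_tsupport hx
  have hRfin : Rfin < ⊤ := by
    obtain ⟨hK, hKQ⟩ := hbox (b' := t₂) (half_pos ht₁)
    set K : Set (ℝ × (EuclideanSpace ℝ (Fin 3))) := Icc (t₁ / 2) t₂ ×ˢ tsupport ψ with hK_def
    obtain ⟨Mw, hMw⟩ := hK.exists_bound_of_continuousOn (cw.mono hKQ)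
    obtain ⟨Mb, hMb⟩ := hK.exists_bound_of_continuousOn (cb.mono hKQ)
    have hΔc : Continuous (Δ ψ) := continuous_laplacian hψ2
    have hgc : Continuous (gradient ψ) := continuous_gradient_of_contDiff hψ1
    obtain ⟨MΔ, hMΔ⟩ := hψc.isCompact.exists_bound_of_continuousOn hΔc.continuousOn
    obtain ⟨Mg, hMg⟩ := hψc.isCompact.exists_bound_of_continuousOn hgc.continuousOn
    set C₁ : ℝ≥0∞ := ENNReal.ofReal Mw ^ 2 * ENNReal.ofReal MΔ +
      ENNReal.ofReal Mw ^ 2 * ENNReal.ofReal Mb * ENNReal.ofReal Mg with hC₁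
    set C₂ : ℝ≥0∞ := 2 * ENNReal.ofReal Mw * ENNReal.ofReal Mg with hC₂
    have hC₁t : C₁ ≠ ⊤ := by
      simp only [hC₁]; exact ENNReal.add_ne_top.2 ⟨ENNReal.mul_ne_top (ENNReal.pow_ne_top
        ENNReal.ofReal_ne_top) ENNReal.ofReal_ne_top, ENNReal.mul_ne_top (ENNReal.mul_ne_top
        (ENNReal.pow_ne_top ENNReal.ofReal_ne_top) ENNReal.ofReal_ne_top) ENNReal.ofReal_ne_top⟩
    have hC₂t : C₂ ≠ ⊤ := ENNReal.mul_ne_top (ENNReal.mul_ne_top (by norm_num) ENNReal.ofReal_ne_top)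
      ENNReal.ofReal_ne_top
    -- pointwise bound on `T`
    have hpt : ∀ z ∈ T, (‖w z.1 z.2‖ₑ ^ 2 * ‖(Δ ψ) z.2‖ₑ + ‖w z.1 z.2‖ₑ ^ 2 * ‖mollifiedDrift η ε w z.1 z.2‖ₑ * ‖gradient ψ z.2‖ₑ + 2 * ‖ϖ z.1 z.2‖ₑ * ‖w z.1 z.2‖ₑ * ‖gradient ψ z.2‖ₑ) ≤
        K.indicator (fun z => C₁ + C₂ * ‖ϖ z.1 z.2‖ₑ) z := by
      rintro ⟨s, x⟩ hz
      dsimp only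
      by_cases hx : x ∈ tsupport ψ
      · have hzK : ((s, x) : ℝ × (EuclideanSpace ℝ (Fin 3))) ∈ K := ⟨⟨hz.1.1.le, hz.1.2.le⟩, hx⟩
        rw [indicator_of_mem hzK]
        have ew : ‖w s x‖ₑ ≤ ENNReal.ofReal Mw := by
          rw [← ofReal_norm]; exact ENNReal.ofReal_le_ofReal (hMw (s, x) hzK)
        have eb : ‖mollifiedDrift η ε w s x‖ₑ ≤ ENNReal.ofReal Mb := by
          rw [← ofReal_norm]; exact ENNReal.ofReal_le_ofReal (hMb (s, x) hzK)
        have eΔ : ‖(Δ ψ) x‖ₑ ≤ ENNReal.ofReal MΔ := by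
          rw [← ofReal_norm]; exact ENNReal.ofReal_le_ofReal (hMΔ x hx)
        have eg : ‖gradient ψ x‖ₑ ≤ ENNReal.ofReal Mg := by
          rw [← ofReal_norm]; exact ENNReal.ofReal_le_ofReal (hMg x hx)
        calc (‖w s x‖ₑ ^ 2 * ‖(Δ ψ) x‖ₑ + ‖w s x‖ₑ ^ 2 * ‖mollifiedDrift η ε w s x‖ₑ * ‖gradient ψ x‖ₑ + 2 * ‖ϖ s x‖ₑ * ‖w s x‖ₑ * ‖gradient ψ x‖ₑ)
            ≤ ENNReal.ofReal Mw ^ 2 * ENNReal.ofReal MΔ +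
              ENNReal.ofReal Mw ^ 2 * ENNReal.ofReal Mb * ENNReal.ofReal Mg +
              2 * ‖ϖ s x‖ₑ * ENNReal.ofReal Mw * ENNReal.ofReal Mg := by
              gcongr
          _ = C₁ + C₂ * ‖ϖ s x‖ₑ := by
              simp only [hC₁, hC₂]
              ring
      · have hzK : ((s, x) : ℝ × (EuclideanSpace ℝ (Fin 3))) ∉ K := fun h' => hx h'.2
        rw [indicator_of_notMem hzK]
        simp [hΔ0 x hx, hg0 x hx]
    have hϖK : ∫⁻ z in K, ‖ϖ z.1 z.2‖ₑ < ⊤ :=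
      (h.locallyIntegrableOn_pressure.integrableOn_compact_subset hKQ hK).2
    calc Rfin ≤ ∫⁻ z in T, K.indicator (fun z => C₁ + C₂ * ‖ϖ z.1 z.2‖ₑ) z :=
          setLIntegral_mono' hTm hpt
      _ ≤ ∫⁻ z, K.indicator (fun z => C₁ + C₂ * ‖ϖ z.1 z.2‖ₑ) z := setLIntegral_le_lintegral _ _
      _ = ∫⁻ z in K, (C₁ + C₂ * ‖ϖ z.1 z.2‖ₑ) := lintegral_indicator hK.measurableSet _
      _ = C₁ * volume K + C₂ * ∫⁻ z in K, ‖ϖ z.1 z.2‖ₑ := by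
          rw [lintegral_add_left measurable_const, setLIntegral_const,
            lintegral_const_mul' _ _ hC₂t]
      _ < ⊤ := ENNReal.add_lt_top.2 ⟨ENNReal.mul_lt_top hC₁t.lt_top hK.measure_lt_top,
          ENNReal.mul_lt_top hC₂t.lt_top hϖK⟩
  -- ### the dissipation integrals on the plateaux and on `(t₁, t₂)`
  set S : ℕ → Set (ℝ × (EuclideanSpace ℝ (Fin 3))) := fun n => Ioo t₁ (t₂ - 2 * e n) ×ˢ (univ : Set (EuclideanSpace ℝ (Fin 3))) with hS_def
  set L : ℕ → ℝ≥0∞ := fun n => ∫⁻ z in S n, ENNReal.ofReal (Gr z) with hL_def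
  set Lt : ℝ≥0∞ := ∫⁻ z in Ioo t₁ t₂ ×ˢ (univ : Set (EuclideanSpace ℝ (Fin 3))), ENNReal.ofReal (Gr z) with hLt_def
  have hSQ : ∀ n, S n ⊆ Q := fun n => prod_mono (fun t ht => ht₁.trans ht.1) subset_rfl
  have hLt_top : Lt < ⊤ := by
    obtain ⟨hK, hKQ⟩ := hbox (b' := t₂) ht₁
    set K : Set (ℝ × (EuclideanSpace ℝ (Fin 3))) := Icc t₁ t₂ ×ˢ tsupport ψ with hK_def
    obtain ⟨MG, hMG⟩ := hK.exists_bound_of_continuousOn (cGr.mono hKQ)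
    have hpt : ∀ z ∈ Ioo t₁ t₂ ×ˢ (univ : Set (EuclideanSpace ℝ (Fin 3))), ENNReal.ofReal (Gr z) ≤
        K.indicator (fun _ => ENNReal.ofReal MG) z := by
      rintro ⟨s, x⟩ hz
      by_cases hx : x ∈ tsupport ψ
      · have hzK : ((s, x) : ℝ × (EuclideanSpace ℝ (Fin 3))) ∈ K := ⟨⟨hz.1.1.le, hz.1.2.le⟩, hx⟩
        rw [indicator_of_mem hzK]
        exact ENNReal.ofReal_le_ofReal ((le_abs_self _).trans ((Real.norm_eq_abs _).symm.le.trans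
          (hMG (s, x) hzK)))
      · simp [hGr_def, image_eq_zero_of_notMem_tsupport hx]
    calc Lt ≤ ∫⁻ z in Ioo t₁ t₂ ×ˢ (univ : Set (EuclideanSpace ℝ (Fin 3))), K.indicator (fun _ => ENNReal.ofReal MG) z :=
          setLIntegral_mono' (measurableSet_Ioo.prod MeasurableSet.univ) hpt
      _ ≤ ∫⁻ z, K.indicator (fun _ => ENNReal.ofReal MG) z := setLIntegral_le_lintegral _ _
      _ = ENNReal.ofReal MG * volume K := by
          rw [lintegral_indicator hK.measurableSet, setLIntegral_const]
      _ < ⊤ := ENNReal.mul_lt_top ENNReal.ofReal_lt_top hK.measure_lt_top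
  have hL_le : ∀ n, L n ≤ Lt := fun n =>
    lintegral_mono_set (prod_mono (Ioo_subset_Ioo le_rfl (by linarith [he_pos n])) subset_rfl)
  have hL_top : ∀ n, L n ≠ ⊤ := fun n => ((hL_le n).trans_lt hLt_top).ne
  -- `Lₙ ↑ L_{(t₁,t₂)}`
  have hL_lim : Tendsto L atTop (𝓝 Lt) := by
    have hanti : Antitone e := fun m n hmn => by
      simp only [he_def]
      exact div_le_div_of_nonneg_left hδ₀pos.le (by positivity) (by exact_mod_cast Nat.add_le_add_right hmn 1)
    have hmono : Monotone S := fun m n hmn =>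
      prod_mono (Ioo_subset_Ioo le_rfl (by linarith [hanti hmn])) subset_rfl
    have hU : (⋃ n, S n) = Ioo t₁ t₂ ×ˢ (univ : Set (EuclideanSpace ℝ (Fin 3))) := by
      rw [hS_def, ← iUnion_prod_const]
      congr 1
      · refine Subset.antisymm (iUnion_subset fun n => Ioo_subset_Ioo le_rfl (by linarith [he_pos n]))
          fun s hs => ?_
        have hev : ∀ᶠ n in atTop, e n < (t₂ - s) / 2 :=
          he_lim.eventually (gt_mem_nhds (by linarith [hs.2]))
        obtain ⟨n, hn⟩ := hev.exists
        exact mem_iUnion.2 ⟨n, hs.1, by linarith⟩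
    have hmonoL : Monotone L := fun m n hmn => lintegral_mono_set (hmono hmn)
    have hsup : Lt = ⨆ n, L n := by
      rw [hLt_def, ← hU]
      exact setLIntegral_iUnion_of_directed _ hmono.directed_le
    rw [hsup]
    exact tendsto_atTop_iSup hmonoL
  -- ### the inequality at level `n`
  have hstep : ∀ n, (∫ s, kb n s * A s) + 2 * (L n).toReal ≤ (∫ s, ka n s * A s) + Rfin.toReal := by
    intro n
    obtain ⟨hIa, hFa⟩ := hFub n (ka n) (hkac n) (hka0 n)
    obtain ⟨hIb, hFb⟩ := hFub n (kb n) (hkbc n) (hkb0 n)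
    -- split the first integral of the identity
    have hsplit : ∫ z in Q, ‖w z.1 z.2‖ ^ 2 * ((ka n z.1 - kb n z.1) * ψ z.2 + θ n z.1 * (Δ ψ) z.2) =
        (∫ s, ka n s * A s) - (∫ s, kb n s * A s) +
          ∫ z in Q, ‖w z.1 z.2‖ ^ 2 * (θ n z.1 * (Δ ψ) z.2) := by
      have hIab : IntegrableOn (fun z : ℝ × (EuclideanSpace ℝ (Fin 3)) =>
          ‖w z.1 z.2‖ ^ 2 * (ka n z.1 * ψ z.2) - ‖w z.1 z.2‖ ^ 2 * (kb n z.1 * ψ z.2)) Q volume :=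
        hIa.sub hIb
      rw [← hFa, ← hFb, ← integral_sub hIa hIb, ← integral_add hIab (hFθ n)]
      refine integral_congr_ae (ae_of_all _ fun z => ?_)
      ring
    -- the three remaining integrals are bounded by their moduli on `T`
    set I₂ : ℝ := ∫ z in Q, ‖w z.1 z.2‖ ^ 2 * (θ n z.1 * (Δ ψ) z.2) with hI₂
    set I₃ : ℝ := ∫ z in Q, ‖w z.1 z.2‖ ^ 2 * (θ n z.1 * ⟪mollifiedDrift η ε w z.1 z.2, gradient ψ z.2⟫) with hI₃
    set I₄ : ℝ := ∫ z in Q, 2 * ϖ z.1 z.2 * (θ n z.1 * ⟪w z.1 z.2, gradient ψ z.2⟫) with hI₄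
    have hθT : ∀ z ∈ Q, θ n z.1 ≠ 0 → z ∈ T := by
      intro z hz hθz
      refine ⟨⟨?_, ?_⟩, mem_univ _⟩
      · by_contra h'
        exact hθz (hθa n z.1 (by linarith [not_lt.1 h', he_t₁ n]))
      · by_contra h'
        exact hθz (hθb n z.1 (by linarith [not_lt.1 h', he_pos n]))
    have hθ1' : ∀ t, ‖θ n t‖ₑ ≤ 1 := fun t => by
      rw [Real.enorm_eq_ofReal (hθ01 n t).1, ← ENNReal.ofReal_one]
      exact ENNReal.ofReal_le_ofReal (hθ01 n t).2
    -- generic comparison: `‖∫_Q f‖ₑ ≤ ∫⁻_T g` when `‖f‖ₑ ≤ g` where `θ ≠ 0` and `f = 0` where `θ = 0`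
    have hcmp : ∀ (f : ℝ × (EuclideanSpace ℝ (Fin 3)) → ℝ) (g : ℝ × (EuclideanSpace ℝ (Fin 3)) → ℝ≥0∞),
        (∀ z ∈ Q, θ n z.1 = 0 → f z = 0) → (∀ z ∈ Q, ‖f z‖ₑ ≤ g z) →
        ‖∫ z in Q, f z‖ₑ ≤ ∫⁻ z in T, g z := by
      intro f g hf0 hfg
      calc ‖∫ z in Q, f z‖ₑ ≤ ∫⁻ z in Q, ‖f z‖ₑ := enorm_integral_le_lintegral_enorm _
        _ = ∫⁻ z, Q.indicator (fun z => ‖f z‖ₑ) z := (lintegral_indicator hQopen.measurableSet _).symm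
        _ ≤ ∫⁻ z, T.indicator g z := by
            refine lintegral_mono fun z => ?_
            by_cases hz : z ∈ Q
            · rw [indicator_of_mem hz]
              by_cases hθz : θ n z.1 = 0
              · simp [hf0 z hz hθz]
              · rw [indicator_of_mem (hθT z hz hθz)]
                exact hfg z hz
            · simp [indicator_of_notMem hz]
        _ = ∫⁻ z in T, g z := lintegral_indicator hTm _
    have hb2 : ‖I₂‖ₑ ≤ ∫⁻ z in T, ‖w z.1 z.2‖ₑ ^ 2 * ‖(Δ ψ) z.2‖ₑ := by
      refine hcmp _ _ (fun z _ hθz => by simp [hθz]) (fun z _ => ?_)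
      rw [enorm_mul, enorm_mul, enorm_pow, enorm_norm]
      calc ‖w z.1 z.2‖ₑ ^ 2 * (‖θ n z.1‖ₑ * ‖(Δ ψ) z.2‖ₑ)
          ≤ ‖w z.1 z.2‖ₑ ^ 2 * (1 * ‖(Δ ψ) z.2‖ₑ) := by gcongr; exact hθ1' _
        _ = _ := by rw [one_mul]
    have hb3 : ‖I₃‖ₑ ≤ ∫⁻ z in T, ‖w z.1 z.2‖ₑ ^ 2 * ‖mollifiedDrift η ε w z.1 z.2‖ₑ * ‖gradient ψ z.2‖ₑ := by
      refine hcmp _ _ (fun z _ hθz => by simp [hθz]) (fun z _ => ?_)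
      rw [enorm_mul, enorm_mul, enorm_pow, enorm_norm]
      have hin : ‖⟪mollifiedDrift η ε w z.1 z.2, gradient ψ z.2⟫‖ₑ ≤ ‖mollifiedDrift η ε w z.1 z.2‖ₑ * ‖gradient ψ z.2‖ₑ := by
        rw [← ofReal_norm, ← ofReal_norm, ← ofReal_norm, ← ENNReal.ofReal_mul (norm_nonneg _)]
        exact ENNReal.ofReal_le_ofReal (norm_inner_le_norm _ _)
      calc ‖w z.1 z.2‖ₑ ^ 2 * (‖θ n z.1‖ₑ * ‖⟪mollifiedDrift η ε w z.1 z.2, gradient ψ z.2⟫‖ₑ)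
          ≤ ‖w z.1 z.2‖ₑ ^ 2 * (1 * (‖mollifiedDrift η ε w z.1 z.2‖ₑ * ‖gradient ψ z.2‖ₑ)) := by
            gcongr; exact hθ1' _
        _ = _ := by rw [one_mul, mul_assoc]
    have hb4 : ‖I₄‖ₑ ≤ ∫⁻ z in T, 2 * ‖ϖ z.1 z.2‖ₑ * ‖w z.1 z.2‖ₑ * ‖gradient ψ z.2‖ₑ := by
      refine hcmp _ _ (fun z _ hθz => by simp [hθz]) (fun z _ => ?_)
      rw [enorm_mul, enorm_mul, enorm_mul]
      have hin : ‖⟪w z.1 z.2, gradient ψ z.2⟫‖ₑ ≤ ‖w z.1 z.2‖ₑ * ‖gradient ψ z.2‖ₑ := by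
        rw [← ofReal_norm, ← ofReal_norm, ← ofReal_norm, ← ENNReal.ofReal_mul (norm_nonneg _)]
        exact ENNReal.ofReal_le_ofReal (norm_inner_le_norm _ _)
      have h2 : ‖(2 : ℝ)‖ₑ = 2 := by
        rw [Real.enorm_eq_ofReal zero_le_two, ENNReal.ofReal_ofNat]
      rw [h2]
      calc 2 * ‖ϖ z.1 z.2‖ₑ * (‖θ n z.1‖ₑ * ‖⟪w z.1 z.2, gradient ψ z.2⟫‖ₑ)
          ≤ 2 * ‖ϖ z.1 z.2‖ₑ * (1 * (‖w z.1 z.2‖ₑ * ‖gradient ψ z.2‖ₑ)) := by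
            gcongr; exact hθ1' _
        _ = _ := by rw [one_mul, ← mul_assoc]
    -- measurability of the first two moduli on `T` (to add the lower integrals)
    have hmT : ∀ {U : ℝ × (EuclideanSpace ℝ (Fin 3)) → (EuclideanSpace ℝ (Fin 3))}, ContinuousOn U Q → AEStronglyMeasurable U (volume.restrict T) :=
      fun hU => (hU.mono hTQ).aestronglyMeasurable hTm
    have hgc : Continuous (gradient ψ) := continuous_gradient_of_contDiff hψ1
    have hΔc : Continuous (Δ ψ) := continuous_laplacian hψ2
    have m1 : AEMeasurable (fun z : ℝ × (EuclideanSpace ℝ (Fin 3)) => ‖w z.1 z.2‖ₑ ^ 2 * ‖(Δ ψ) z.2‖ₑ) (volume.restrict T) :=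
      ((hmT cw').enorm.pow_const 2).mul (hΔc.comp continuous_snd).aestronglyMeasurable.enorm
    have m2 : AEMeasurable (fun z : ℝ × (EuclideanSpace ℝ (Fin 3)) => ‖w z.1 z.2‖ₑ ^ 2 * ‖mollifiedDrift η ε w z.1 z.2‖ₑ * ‖gradient ψ z.2‖ₑ)
        (volume.restrict T) :=
      (((hmT cw').enorm.pow_const 2).mul (hmT cb').enorm).mul
        (hgc.comp continuous_snd).aestronglyMeasurable.enorm
    have hsum : ‖I₂‖ₑ + ‖I₃‖ₑ + ‖I₄‖ₑ ≤ Rfin := by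
      calc ‖I₂‖ₑ + ‖I₃‖ₑ + ‖I₄‖ₑ
          ≤ (∫⁻ z in T, ‖w z.1 z.2‖ₑ ^ 2 * ‖(Δ ψ) z.2‖ₑ) +
            (∫⁻ z in T, ‖w z.1 z.2‖ₑ ^ 2 * ‖mollifiedDrift η ε w z.1 z.2‖ₑ * ‖gradient ψ z.2‖ₑ) +
            ∫⁻ z in T, 2 * ‖ϖ z.1 z.2‖ₑ * ‖w z.1 z.2‖ₑ * ‖gradient ψ z.2‖ₑ :=
            add_le_add (add_le_add hb2 hb3) hb4
        _ = Rfin := by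
            have m12 : AEMeasurable (fun z : ℝ × (EuclideanSpace ℝ (Fin 3)) => ‖w z.1 z.2‖ₑ ^ 2 * ‖(Δ ψ) z.2‖ₑ +
                ‖w z.1 z.2‖ₑ ^ 2 * ‖mollifiedDrift η ε w z.1 z.2‖ₑ * ‖gradient ψ z.2‖ₑ)
                (volume.restrict T) := m1.add m2
            rw [← lintegral_add_left' m1, ← lintegral_add_left' m12]
    have hfin₂ : ‖I₂‖ₑ ≠ ⊤ := enorm_ne_top
    have hfin₃ : ‖I₃‖ₑ ≠ ⊤ := enorm_ne_top
    have hfin₄ : ‖I₄‖ₑ ≠ ⊤ := enorm_ne_top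
    have hX : I₂ + I₃ + I₄ ≤ Rfin.toReal := by
      have h1 : I₂ + I₃ + I₄ ≤ ‖I₂‖ + ‖I₃‖ + ‖I₄‖ :=
        add_le_add (add_le_add (Real.le_norm_self _) (Real.le_norm_self _)) (Real.le_norm_self _)
      refine h1.trans ?_
      rw [← toReal_enorm, ← toReal_enorm, ← toReal_enorm, ← ENNReal.toReal_add hfin₂ hfin₃,
        ← ENNReal.toReal_add (ENNReal.add_ne_top.2 ⟨hfin₂, hfin₃⟩) hfin₄]
      exact ENNReal.toReal_mono hRfin.ne hsum
    -- the dissipation term dominates `Lₙ`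
    have hD : (L n).toReal ≤ ∫ z in Q, θ n z.1 * Gr z := by
      have hnn : 0 ≤ᵐ[volume.restrict Q] fun z => θ n z.1 * Gr z := by
        rw [EventuallyLE, ae_restrict_iff' hQopen.measurableSet]
        exact ae_of_all _ fun z hz => mul_nonneg (hθ01 n _).1 (hGr0 z hz)
      refine ENNReal.toReal_le_of_le_ofReal (integral_nonneg_of_ae hnn) ?_
      rw [ofReal_integral_eq_lintegral_ofReal (hFG n) hnn]
      calc L n = ∫⁻ z in S n, ENNReal.ofReal (θ n z.1 * Gr z) := by
            refine setLIntegral_congr_fun (measurableSet_Ioo.prod MeasurableSet.univ) fun z hz => ?_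
            rw [hθ1 n z.1 ⟨by linarith [hz.1.1, he_pos n], hz.1.2.le⟩, one_mul]
        _ ≤ ∫⁻ z in Q, ENNReal.ofReal (θ n z.1 * Gr z) := lintegral_mono_set (hSQ n)
    -- assemble
    have E := key n
    rw [hsplit] at E
    linarith
  -- ### the limit `n → ∞`
  have hTa : Tendsto (fun n => ∫ s, ka n s * A s) atTop (𝓝 (A t₁)) :=
    tendsto_integral_kernel_mul_of_continuousOn isOpen_Ioi hAcont ht₁ he_pos he_lim hkac hkab
      hkas hka1
  have hTb : Tendsto (fun n => ∫ s, kb n s * A s) atTop (𝓝 (A t₂)) :=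
    tendsto_integral_kernel_mul_of_continuousOn isOpen_Ioi hAcont (ht₁.trans h12) he_pos he_lim
      hkbc hkbb hkbs hkb1
  have hLr : Tendsto (fun n => (L n).toReal) atTop (𝓝 Lt.toReal) :=
    (ENNReal.tendsto_toReal hLt_top.ne).comp hL_lim
  have hlim : A t₂ + 2 * Lt.toReal ≤ A t₁ + Rfin.toReal :=
    le_of_tendsto_of_tendsto' (hTb.add (hLr.const_mul 2)) (hTa.add_const _) hstep
  -- ### back to `ℝ≥0∞`
  have hRle : Rfin ≤ ∫⁻ z in Ioo 0 t₂ ×ˢ (univ : Set (EuclideanSpace ℝ (Fin 3))), (‖w z.1 z.2‖ₑ ^ 2 * ‖(Δ ψ) z.2‖ₑ + ‖w z.1 z.2‖ₑ ^ 2 * ‖mollifiedDrift η ε w z.1 z.2‖ₑ * ‖gradient ψ z.2‖ₑ + 2 * ‖ϖ z.1 z.2‖ₑ * ‖w z.1 z.2‖ₑ * ‖gradient ψ z.2‖ₑ) :=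
    lintegral_mono_set (prod_mono (Ioo_subset_Ioo (half_pos ht₁).le le_rfl) subset_rfl)
  show ENNReal.ofReal (A t₂) + 2 * Lt ≤ ENNReal.ofReal (A t₁) + _
  calc ENNReal.ofReal (A t₂) + 2 * Lt
      = ENNReal.ofReal (A t₂ + 2 * Lt.toReal) := by
        rw [ENNReal.ofReal_add (hA0 _) (by positivity), ENNReal.ofReal_mul zero_le_two,
          ENNReal.ofReal_ofNat, ENNReal.ofReal_toReal hLt_top.ne]
    _ ≤ ENNReal.ofReal (A t₁ + Rfin.toReal) := ENNReal.ofReal_le_ofReal hlim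
    _ = ENNReal.ofReal (A t₁) + Rfin := by
        rw [ENNReal.ofReal_add (hA0 _) ENNReal.toReal_nonneg, ENNReal.ofReal_toReal hRfin.ne]
    _ ≤ ENNReal.ofReal (A t₁) + ∫⁻ z in Ioo 0 t₂ ×ˢ (univ : Set (EuclideanSpace ℝ (Fin 3))), (‖w z.1 z.2‖ₑ ^ 2 * ‖(Δ ψ) z.2‖ₑ + ‖w z.1 z.2‖ₑ ^ 2 * ‖mollifiedDrift η ε w z.1 z.2‖ₑ * ‖gradient ψ z.2‖ₑ + 2 * ‖ϖ z.1 z.2‖ₑ * ‖w z.1 z.2‖ₑ * ‖gradient ψ z.2‖ₑ) :=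
        add_le_add le_rfl hRle
  exact le_rfl

end Members

/-! ## The initial time: weighted local energies along `t → 0⁺` -/

/-- **Weighted local energies converge at `t = 0`.** If `w(t) → v₀` in `L²(K)` for every compact
`K` as `t → 0⁺` (the field `initial` of the class), the slices `w(t)` are eventually
a.e.-strongly measurable, `v₀` is a.e.-strongly measurable and `∫|v₀|²ψ < ∞` for a continuous
compactly supported weight `ψ ≥ 0`, then `∫|w(t)|²ψ → ∫|v₀|²ψ` (Minkowski in `L²(ψ dx)`:
`|‖√ψ w(t)‖₂ − ‖√ψ v₀‖₂| ≤ ‖√ψ (w(t) − v₀)‖₂ ≤ (sup ψ)^{1/2}‖w(t) − v₀‖_{L²(supp ψ)} → 0`; the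
weighted form of the accepted `IsMollifiedApproximant.tendsto_ballEnergy`). [cite: BradshawTsai2019, §3 proof of Prop 3.1 ("v_ε(t) → v₀ in L²_loc", p. 8)] -/
theorem tendsto_lintegral_sq_mul_of_initial {w : ℝ → (EuclideanSpace ℝ (Fin 3)) → (EuclideanSpace ℝ (Fin 3))} {v₀ : (EuclideanSpace ℝ (Fin 3)) → (EuclideanSpace ℝ (Fin 3))}
    (hinit : ∀ K : Set (EuclideanSpace ℝ (Fin 3)), IsCompact K →
      Tendsto (fun t => ∫⁻ x in K, ‖w t x - v₀ x‖ₑ ^ 2) (𝓝[>] 0) (𝓝 0))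
    (hws : ∀ t, 0 < t → AEStronglyMeasurable (w t) volume) (hv₀ : AEStronglyMeasurable v₀ volume)
    {ψ : (EuclideanSpace ℝ (Fin 3)) → ℝ} (hψ : Continuous ψ) (hψc : HasCompactSupport ψ) (hψ0 : ∀ x, 0 ≤ ψ x)
    (hfin : ∫⁻ x, ‖v₀ x‖ₑ ^ 2 * ENNReal.ofReal (ψ x) < ⊤) :
    Tendsto (fun t => ∫⁻ x, ‖w t x‖ₑ ^ 2 * ENNReal.ofReal (ψ x)) (𝓝[>] 0)
      (𝓝 (∫⁻ x, ‖v₀ x‖ₑ ^ 2 * ENNReal.ofReal (ψ x))) := by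
  -- the weight `ρ = √ψ`, so that `ψ = ρ²`
  set ρ : (EuclideanSpace ℝ (Fin 3)) → ℝ≥0∞ := fun x => ENNReal.ofReal (Real.sqrt (ψ x)) with hρ
  have hρm : Measurable ρ := (hψ.measurable.sqrt).ennreal_ofReal
  have hρ2 : ∀ x, ENNReal.ofReal (ψ x) = ρ x ^ 2 := fun x => by
    rw [hρ, ← ENNReal.ofReal_pow (Real.sqrt_nonneg _), Real.sq_sqrt (hψ0 x)]
  have hsq : ∀ (u : (EuclideanSpace ℝ (Fin 3)) → (EuclideanSpace ℝ (Fin 3))) x, ‖u x‖ₑ ^ 2 * ENNReal.ofReal (ψ x) = (‖u x‖ₑ * ρ x) ^ 2 :=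
    fun u x => by rw [hρ2, mul_pow]
  obtain ⟨Mψ, hMψ⟩ := hψ.bounded_above_of_compact_support hψc
  have hρb : ∀ x, ρ x ^ 2 ≤ ENNReal.ofReal Mψ := fun x => by
    rw [← hρ2]
    exact ENNReal.ofReal_le_ofReal ((le_abs_self _).trans ((Real.norm_eq_abs _).symm.le.trans (hMψ x)))
  have hρ0 : ∀ x, x ∉ tsupport ψ → ρ x = 0 := fun x hx => by
    simp [hρ, image_eq_zero_of_notMem_tsupport hx]
  -- the three quantities
  set L : ℝ → ℝ≥0∞ := fun t => ∫⁻ x, (‖w t x‖ₑ * ρ x) ^ 2 with hL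
  set l : ℝ≥0∞ := ∫⁻ x, (‖v₀ x‖ₑ * ρ x) ^ 2 with hl
  set d : ℝ → ℝ≥0∞ := fun t => ∫⁻ x, (‖w t x - v₀ x‖ₑ * ρ x) ^ 2 with hd
  have eL : (fun t => ∫⁻ x, ‖w t x‖ₑ ^ 2 * ENNReal.ofReal (ψ x)) = L := by
    funext t; simp only [hL, hsq]
  have el : ∫⁻ x, ‖v₀ x‖ₑ ^ 2 * ENNReal.ofReal (ψ x) = l := by simp only [hl, hsq]
  rw [eL, el]
  rw [el] at hfin
  -- `d t → 0`
  have hd0 : Tendsto d (𝓝[>] 0) (𝓝 0) := by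
    have h1 := hinit (tsupport ψ) hψc
    have hbound : ∀ t, d t ≤ ENNReal.ofReal Mψ * ∫⁻ x in tsupport ψ, ‖w t x - v₀ x‖ₑ ^ 2 := by
      intro t
      calc d t = ∫⁻ x, (tsupport ψ).indicator (fun x => (‖w t x - v₀ x‖ₑ * ρ x) ^ 2) x := by
            refine lintegral_congr fun x => ?_
            by_cases hx : x ∈ tsupport ψ
            · rw [indicator_of_mem hx]
            · rw [indicator_of_notMem hx, hρ0 x hx, mul_zero, zero_pow two_ne_zero]
        _ = ∫⁻ x in tsupport ψ, (‖w t x - v₀ x‖ₑ * ρ x) ^ 2 :=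
            lintegral_indicator (isClosed_tsupport ψ).measurableSet _
        _ ≤ ∫⁻ x in tsupport ψ, ENNReal.ofReal Mψ * ‖w t x - v₀ x‖ₑ ^ 2 := by
            refine lintegral_mono fun x => ?_
            rw [mul_pow, mul_comm]
            exact mul_le_mul' (hρb x) le_rfl
        _ = ENNReal.ofReal Mψ * ∫⁻ x in tsupport ψ, ‖w t x - v₀ x‖ₑ ^ 2 :=
            lintegral_const_mul' _ _ ENNReal.ofReal_ne_top
    have h2 : Tendsto (fun t => ENNReal.ofReal Mψ * ∫⁻ x in tsupport ψ, ‖w t x - v₀ x‖ₑ ^ 2)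
        (𝓝[>] 0) (𝓝 0) := by
      have := ENNReal.Tendsto.const_mul (a := ENNReal.ofReal Mψ) h1 (Or.inr ENNReal.ofReal_ne_top)
      rwa [mul_zero] at this
    exact tendsto_of_tendsto_of_tendsto_of_le_of_le tendsto_const_nhds h2 (fun t => bot_le) hbound
  -- square roots and Minkowski, as in `tendsto_ballEnergy`
  set S : ℝ≥0∞ → ℝ≥0∞ := fun a => a ^ (1 / 2 : ℝ) with hS
  have hScont : Continuous S := ENNReal.continuous_rpow_const
  have hS2 : ∀ a : ℝ≥0∞, S a ^ (2 : ℝ) = a := fun a => by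
    rw [hS, ← ENNReal.rpow_mul]; norm_num
  have hv₀m : AEMeasurable (fun x => ‖v₀ x‖ₑ * ρ x) volume := hv₀.enorm.mul hρm.aemeasurable
  have hmink : ∀ t : ℝ, 0 < t → S (L t) ≤ S l + S (d t) ∧ S l ≤ S (L t) + S (d t) := by
    intro t ht
    have hwm : AEStronglyMeasurable (w t) volume := hws t ht
    have hdm : AEMeasurable (fun x => ‖w t x - v₀ x‖ₑ * ρ x) volume :=
      (hwm.sub hv₀).enorm.mul hρm.aemeasurable
    have hdm' : AEMeasurable (fun x => ‖v₀ x - w t x‖ₑ * ρ x) volume :=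
      (hv₀.sub hwm).enorm.mul hρm.aemeasurable
    have hLm : AEMeasurable (fun x => ‖w t x‖ₑ * ρ x) volume := hwm.enorm.mul hρm.aemeasurable
    refine ⟨sqrt_lintegral_sq_le_add hv₀m hdm fun x => ?_, ?_⟩
    · calc ‖w t x‖ₑ * ρ x = ‖v₀ x + (w t x - v₀ x)‖ₑ * ρ x := by rw [add_sub_cancel]
        _ ≤ (‖v₀ x‖ₑ + ‖w t x - v₀ x‖ₑ) * ρ x := mul_le_mul' (enorm_add_le _ _) le_rfl
        _ = ‖v₀ x‖ₑ * ρ x + ‖w t x - v₀ x‖ₑ * ρ x := add_mul _ _ _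
    · have h3 : d t = ∫⁻ x, (‖v₀ x - w t x‖ₑ * ρ x) ^ 2 :=
        lintegral_congr fun x => by rw [enorm_sub_rev]
      rw [h3]
      refine sqrt_lintegral_sq_le_add hLm hdm' fun x => ?_
      calc ‖v₀ x‖ₑ * ρ x = ‖w t x + (v₀ x - w t x)‖ₑ * ρ x := by rw [add_sub_cancel]
        _ ≤ (‖w t x‖ₑ + ‖v₀ x - w t x‖ₑ) * ρ x := mul_le_mul' (enorm_add_le _ _) le_rfl
        _ = ‖w t x‖ₑ * ρ x + ‖v₀ x - w t x‖ₑ * ρ x := add_mul _ _ _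
  have hSl : S l ≠ ⊤ := (ENNReal.rpow_lt_top_of_nonneg (by norm_num) hfin.ne).ne
  have hSd : Tendsto (fun t => S (d t)) (𝓝[>] 0) (𝓝 0) := by
    have := (hScont.tendsto 0).comp hd0
    rwa [show S 0 = 0 from ENNReal.zero_rpow_of_pos (by norm_num)] at this
  have hlow : Tendsto (fun t => S l - S (d t)) (𝓝[>] 0) (𝓝 (S l)) := by
    have := ((ENNReal.continuous_sub_left hSl).tendsto 0).comp hSd
    rwa [tsub_zero] at this
  have hup : Tendsto (fun t => S l + S (d t)) (𝓝[>] 0) (𝓝 (S l)) := by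
    have := tendsto_const_nhds.add hSd (f := fun _ : ℝ => S l)
    rwa [add_zero] at this
  have hev : ∀ᶠ t in 𝓝[>] (0 : ℝ), 0 < t := self_mem_nhdsWithin
  have hSL : Tendsto (fun t => S (L t)) (𝓝[>] 0) (𝓝 (S l)) := by
    refine tendsto_of_tendsto_of_tendsto_of_le_of_le' hlow hup ?_ ?_
    · filter_upwards [hev] with t ht
      exact tsub_le_iff_right.2 (hmink t ht).2
    · filter_upwards [hev] with t ht
      exact (hmink t ht).1
  have hfin' := ((ENNReal.continuous_rpow_const (y := (2 : ℝ))).tendsto (S l)).comp hSL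
  rw [hS2] at hfin'
  refine hfin'.congr fun t => ?_
  exact hS2 (L t)

section Members

variable {c ε : ℝ} {η : (EuclideanSpace ℝ (Fin 3)) → ℝ} {v₀ : (EuclideanSpace ℝ (Fin 3)) → (EuclideanSpace ℝ (Fin 3))} {w : ℝ → (EuclideanSpace ℝ (Fin 3)) → (EuclideanSpace ℝ (Fin 3))} {ϖ : ℝ → (EuclideanSpace ℝ (Fin 3)) → ℝ}

/-- The weighted local energy of a smooth slice as a lower integral:
`ofReal (∫|w(s)|²ψ) = ∫⁻ ‖w(s)‖ₑ² ψ` (`s > 0`, `ψ ≥ 0` continuous with compact support). [folklore] -/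
theorem IsMollifiedApproximant.ofReal_integral_sq_mul (h : IsMollifiedApproximant c ε η v₀ w ϖ)
    {ψ : (EuclideanSpace ℝ (Fin 3)) → ℝ} (hψ : Continuous ψ) (hψc : HasCompactSupport ψ) (hψ0 : ∀ x, 0 ≤ ψ x) {s : ℝ}
    (hs : 0 < s) :
    ENNReal.ofReal (∫ x, ‖w s x‖ ^ 2 * ψ x) = ∫⁻ x, ‖w s x‖ₑ ^ 2 * ENNReal.ofReal (ψ x) := by
  have hc : Continuous fun x => ‖w s x‖ ^ 2 * ψ x := ((h.continuous_slice hs).norm.pow 2).mul hψ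
  rw [ofReal_integral_eq_lintegral_ofReal (hc.integrable_of_hasCompactSupport hψc.mul_left)
    (ae_of_all _ fun x => mul_nonneg (sq_nonneg _) (hψ0 x))]
  refine lintegral_congr fun x => ?_
  rw [ENNReal.ofReal_mul (sq_nonneg _), ← ofReal_norm, ENNReal.ofReal_pow (norm_nonneg _)]

/-- **The local energy inequality of a mollified approximant from the initial time**
(Bradshaw–Tsai 2019, (3.7), p. 8, sliced at `t` and from `s = 0`, for a time-independent weight
`ψ ∈ C_c^∞(ℝ³)`, `ψ ≥ 0`, with moduli on the right; in `ℝ≥0∞`): for a member `(v_ε, π_ε)` of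
the class whose datum `v₀` is a.e.-strongly measurable with `∫|v₀|²ψ < ∞`, and every `t > 0`,
`∫|v_ε(t)|²ψ + 2∫₀ᵗ∫ψ|∇v_ε|² ≤ ∫|v₀|²ψ + ∫₀ᵗ∫(|v_ε|²|Δψ| + |v_ε|²|η_{ε√s} * v_ε||∇ψ| + 2|π_ε||v_ε||∇ψ|)`
— the two-time inequality `energy_ineq_Ioo` on `(t₁, t)` and `t₁ → 0⁺` through the initial
condition of the class ("`v_ε(t) → v₀` in `L²_loc`": `tendsto_lintegral_sq_mul_of_initial`) and
monotone convergence of the dissipation term. The right-hand side may be infinite; its finiteness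
(whence that of `∫₀ᵗ∫ψ|∇v_ε|²`) is `lintegral_energyRHS_lt_top` below. [cite: BradshawTsai2019, §3 (3.7) and p. 8] -/
theorem IsMollifiedApproximant.energy_ineq_zero (h : IsMollifiedApproximant c ε η v₀ w ϖ)
    (hη : ContDiff ℝ ∞ η) (hηc : HasCompactSupport η) (hε : 0 < ε)
    {ψ : (EuclideanSpace ℝ (Fin 3)) → ℝ} (hψ : ContDiff ℝ ∞ ψ) (hψc : HasCompactSupport ψ) (hψ0 : ∀ x, 0 ≤ ψ x)
    (hv₀ : AEStronglyMeasurable v₀ volume)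
    (hv₀ψ : ∫⁻ x, ‖v₀ x‖ₑ ^ 2 * ENNReal.ofReal (ψ x) < ⊤) {t : ℝ} (ht : 0 < t) :
    (∫⁻ x, ‖w t x‖ₑ ^ 2 * ENNReal.ofReal (ψ x)) +
        2 * ∫⁻ z in Ioo 0 t ×ˢ (univ : Set (EuclideanSpace ℝ (Fin 3))),
          ENNReal.ofReal (ψ z.2 * frobeniusNormSq (fderiv ℝ (w z.1) z.2)) ≤
      (∫⁻ x, ‖v₀ x‖ₑ ^ 2 * ENNReal.ofReal (ψ x)) +
        ∫⁻ z in Ioo 0 t ×ˢ (univ : Set (EuclideanSpace ℝ (Fin 3))), (‖w z.1 z.2‖ₑ ^ 2 * ‖(Δ ψ) z.2‖ₑ + ‖w z.1 z.2‖ₑ ^ 2 * ‖mollifiedDrift η ε w z.1 z.2‖ₑ * ‖gradient ψ z.2‖ₑ + 2 * ‖ϖ z.1 z.2‖ₑ * ‖w z.1 z.2‖ₑ * ‖gradient ψ z.2‖ₑ) := by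
  set R : ℝ≥0∞ := ∫⁻ z in Ioo 0 t ×ˢ (univ : Set (EuclideanSpace ℝ (Fin 3))), (‖w z.1 z.2‖ₑ ^ 2 * ‖(Δ ψ) z.2‖ₑ + ‖w z.1 z.2‖ₑ ^ 2 * ‖mollifiedDrift η ε w z.1 z.2‖ₑ * ‖gradient ψ z.2‖ₑ + 2 * ‖ϖ z.1 z.2‖ₑ * ‖w z.1 z.2‖ₑ * ‖gradient ψ z.2‖ₑ) with hR
  set 𝔄 : ℝ → ℝ≥0∞ := fun s => ∫⁻ x, ‖w s x‖ₑ ^ 2 * ENNReal.ofReal (ψ x) with h𝔄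
  set Gr : ℝ × (EuclideanSpace ℝ (Fin 3)) → ℝ≥0∞ := fun z => ENNReal.ofReal (ψ z.2 * frobeniusNormSq (fderiv ℝ (w z.1) z.2))
    with hGr
  -- the times `tₙ = t/(n+2) → 0⁺`
  set τ : ℕ → ℝ := fun n => t / (n + 2) with hτ
  have hτpos : ∀ n, 0 < τ n := fun n => div_pos ht (by positivity)
  have hτlt : ∀ n, τ n < t := fun n => by
    rw [hτ]; dsimp only
    rw [div_lt_iff₀ (by positivity)]
    nlinarith [n.cast_nonneg (α := ℝ)]
  have hτlim : Tendsto τ atTop (𝓝[>] 0) := by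
    refine tendsto_nhdsWithin_iff.2 ⟨?_, Eventually.of_forall fun n => hτpos n⟩
    have h1 : Tendsto (fun n : ℕ => t * (1 / ((n : ℝ) + 2))) atTop (𝓝 (t * 0)) := by
      refine tendsto_const_nhds.mul ?_
      have := tendsto_one_div_add_atTop_nhds_zero_nat (𝕜 := ℝ)
      refine (this.comp (tendsto_add_atTop_nat 1)).congr fun n => ?_
      simp only [comp_apply, Nat.cast_add, Nat.cast_one]
      ring
    rw [mul_zero] at h1
    exact h1.congr fun n => by simp only [hτ]; ring
  have hτanti : Antitone τ := fun m n hmn => by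
    simp only [hτ]
    exact div_le_div_of_nonneg_left ht.le (by positivity) (by exact_mod_cast Nat.add_le_add_right hmn 2)
  -- the inequality at level `n`
  have hstep : ∀ n, 𝔄 t + 2 * ∫⁻ z in Ioo (τ n) t ×ˢ (univ : Set (EuclideanSpace ℝ (Fin 3))), Gr z ≤ 𝔄 (τ n) + R := by
    intro n
    have key := h.energy_ineq_Ioo hη hηc hε hψ hψc hψ0 (hτpos n) (hτlt n)
    rwa [h.ofReal_integral_sq_mul hψ.continuous hψc hψ0 ht,
      h.ofReal_integral_sq_mul hψ.continuous hψc hψ0 (hτpos n)] at key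
  -- limits of both sides
  have h𝔄 : Tendsto (fun n => 𝔄 (τ n)) atTop (𝓝 (∫⁻ x, ‖v₀ x‖ₑ ^ 2 * ENNReal.ofReal (ψ x))) :=
    (tendsto_lintegral_sq_mul_of_initial h.initial
      (fun s hs => (h.continuous_slice hs).aestronglyMeasurable) hv₀ hψ.continuous hψc hψ0 hv₀ψ).comp
      hτlim
  have hD : Tendsto (fun n => ∫⁻ z in Ioo (τ n) t ×ˢ (univ : Set (EuclideanSpace ℝ (Fin 3))), Gr z) atTop
      (𝓝 (∫⁻ z in Ioo 0 t ×ˢ (univ : Set (EuclideanSpace ℝ (Fin 3))), Gr z)) := by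
    have hmono : Monotone fun n => Ioo (τ n) t ×ˢ (univ : Set (EuclideanSpace ℝ (Fin 3))) := fun m n hmn =>
      prod_mono (Ioo_subset_Ioo (hτanti hmn) le_rfl) subset_rfl
    have hU : (⋃ n, Ioo (τ n) t ×ˢ (univ : Set (EuclideanSpace ℝ (Fin 3)))) = Ioo 0 t ×ˢ (univ : Set (EuclideanSpace ℝ (Fin 3))) := by
      rw [← iUnion_prod_const]
      congr 1
      refine Subset.antisymm (iUnion_subset fun n => Ioo_subset_Ioo (hτpos n).le le_rfl)
        fun s hs => ?_
      have hev : ∀ᶠ n in atTop, τ n < s :=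
        (tendsto_nhdsWithin_iff.1 hτlim).1.eventually (gt_mem_nhds hs.1)
      obtain ⟨n, hn⟩ := hev.exists
      exact mem_iUnion.2 ⟨n, hn, hs.2⟩
    rw [← hU, setLIntegral_iUnion_of_directed _ hmono.directed_le]
    exact tendsto_atTop_iSup fun m n hmn => lintegral_mono_set (hmono hmn)
  exact le_of_tendsto_of_tendsto' (tendsto_const_nhds.add (ENNReal.Tendsto.const_mul hD
    (Or.inr ENNReal.ofNat_ne_top))) (h𝔄.add tendsto_const_nhds) hstep

/-! ## Finiteness of the right-hand side down to `t = 0` -/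

/-- Splitting a lower integral over `I × ℝ³` at a measurable `B ⊆ ℝ³` off which the integrand
vanishes: `∫∫_{I×ℝ³} F ≤ ∫∫_{I×B} G` when `F ≤ G` on `I × B` and `F = 0` on `I × Bᶜ`. [folklore] -/
theorem setLIntegral_prod_univ_le_of_eq_zero_off {F G : ℝ × (EuclideanSpace ℝ (Fin 3)) → ℝ≥0∞} {I : Set ℝ}
    (hI : MeasurableSet I) {B : Set (EuclideanSpace ℝ (Fin 3))} (hB : MeasurableSet B) (hle : ∀ z ∈ I ×ˢ B, F z ≤ G z)
    (h0 : ∀ z ∈ I ×ˢ Bᶜ, F z = 0) :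
    ∫⁻ z in I ×ˢ (univ : Set (EuclideanSpace ℝ (Fin 3))), F z ≤ ∫⁻ z in I ×ˢ B, G z := by
  have hU : I ×ˢ (univ : Set (EuclideanSpace ℝ (Fin 3))) = I ×ˢ B ∪ I ×ˢ Bᶜ := by rw [← prod_union, union_compl_self]
  calc ∫⁻ z in I ×ˢ (univ : Set (EuclideanSpace ℝ (Fin 3))), F z = ∫⁻ z in I ×ˢ B ∪ I ×ˢ Bᶜ, F z := by rw [hU]
    _ ≤ (∫⁻ z in I ×ˢ B, F z) + ∫⁻ z in I ×ˢ Bᶜ, F z := lintegral_union_le _ _ _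
    _ = (∫⁻ z in I ×ˢ B, F z) + ∫⁻ z in I ×ˢ Bᶜ, (0 : ℝ≥0∞) := by
        rw [setLIntegral_congr_fun (hI.prod hB.compl) h0]
    _ ≤ ∫⁻ z in I ×ˢ B, G z := by
        rw [lintegral_zero, add_zero]; exact setLIntegral_mono' (hI.prod hB) hle

/-- **The running supremum `α̃_ε(s)` of a member is finite** (`s > 0`) when `∫_{B₁}|v₀|² < ∞`:
`α_ε` is continuous on `(0,∞)` (accepted `continuousOn_ballEnergy`), tends to `∫_{B₁}|v₀|²` at
`0⁺` (accepted `tendsto_ballEnergy`), and is finite at each positive time (p. 8: "`α̃_ε(t)` [is]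
continuous"). [cite: BradshawTsai2019, §3 proof of Prop 3.1 (p. 8)] -/
theorem IsMollifiedApproximant.supBallEnergy_lt_top (h : IsMollifiedApproximant c ε η v₀ w ϖ)
    (hv₀ : AEStronglyMeasurable v₀ volume) (hfin : ∫⁻ x in ball (0 : (EuclideanSpace ℝ (Fin 3))) 1, ‖v₀ x‖ₑ ^ 2 < ⊤)
    {s : ℝ} (hs : 0 < s) : supBallEnergy w s < ⊤ := by
  have hcont := h.continuousOn_ballEnergy
  have hlim := h.tendsto_ballEnergy hv₀ hfin
  set l : ℝ≥0∞ := ∫⁻ x in ball (0 : (EuclideanSpace ℝ (Fin 3))) 1, ‖v₀ x‖ₑ ^ 2 with hl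
  have hl1 : l + 1 < ⊤ := ENNReal.add_lt_top.2 ⟨hfin, ENNReal.one_lt_top⟩
  have hev : ∀ᶠ τ in 𝓝[>] (0 : ℝ), ballEnergy w τ < l + 1 :=
    hlim (Iio_mem_nhds (ENNReal.lt_add_right hfin.ne one_ne_zero))
  obtain ⟨δ, hδ0, hδ⟩ : ∃ δ > 0, ∀ τ ∈ Ioo 0 δ, ballEnergy w τ < l + 1 := by
    obtain ⟨u, hu, hsub⟩ := mem_nhdsGT_iff_exists_Ioo_subset.1 hev
    exact ⟨u, hu, fun τ hτ => hsub hτ⟩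
  -- the energy is finite at every positive time
  have hfinτ : ∀ τ, 0 < τ → ballEnergy w τ < ⊤ := by
    intro τ hτ
    obtain ⟨M, hM⟩ := (isCompact_closedBall (0 : (EuclideanSpace ℝ (Fin 3))) 1).exists_bound_of_continuousOn
      (h.continuous_slice hτ).continuousOn
    calc ballEnergy w τ ≤ ∫⁻ x in ball (0 : (EuclideanSpace ℝ (Fin 3))) 1, ENNReal.ofReal M ^ 2 := by
          refine setLIntegral_mono' measurableSet_ball fun x hx => ?_
          have : ‖w τ x‖ₑ ≤ ENNReal.ofReal M := by
            rw [← ofReal_norm]; exact ENNReal.ofReal_le_ofReal (hM x (ball_subset_closedBall hx))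
          exact pow_le_pow_left' this 2
      _ < ⊤ := by
          rw [setLIntegral_const]
          exact ENNReal.mul_lt_top (ENNReal.pow_lt_top ENNReal.ofReal_lt_top) measure_ball_lt_top
  by_cases hδs : s < δ
  · exact lt_of_le_of_lt (iSup₂_le fun τ hτ => (hδ τ ⟨hτ.1, hτ.2.trans_lt hδs⟩).le) hl1
  · have hK : IsCompact (Icc (δ / 2) s) := isCompact_Icc
    have hKsub : Icc (δ / 2) s ⊆ Ioi 0 := fun τ hτ => (half_pos hδ0).trans_le hτ.1
    have hne : (Icc (δ / 2) s).Nonempty := ⟨s, ⟨by linarith [not_lt.1 hδs], le_rfl⟩⟩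
    obtain ⟨τ₀, hτ₀, hmax⟩ := hK.exists_isMaxOn hne (hcont.mono hKsub)
    refine lt_of_le_of_lt (iSup₂_le fun τ hτ => ?_) (max_lt hl1 (hfinτ τ₀ (hKsub hτ₀)))
    by_cases hτδ : τ < δ
    · exact (hδ τ ⟨hτ.1, hτδ⟩).le.trans (le_max_left _ _)
    · exact (hmax ⟨by linarith [not_lt.1 hτδ], hτ.2⟩).trans (le_max_right _ _)

/-- **Finiteness of the right-hand side of the local energy inequality from `t = 0`.** For a
member of the class (`λ > 1`) with `∫_{B₁}|v₀|² < ∞`, if the classes `G = (η_{ε√s} * v_ε) ⊗ v_ε`,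
`π_ε ∈ L²((0,t) × ℝ³)` hold down to `t = 0` (for the abstract class: accepted
`lintegral_drift_sq_Ioo_zero_lt_top`, and `lintegral_pressure_sq_Ioo_zero_lt_top` under (3.8),
`ForwardDSSPressureFormula`), then for every `ψ ∈ C_c^∞(ℝ³)` and `t > 0`,
`∫₀ᵗ∫(|v_ε|²|Δψ| + |v_ε|²|b||∇ψ| + 2|π_ε||v_ε||∇ψ|) < ∞`: the first term by the scaling law
(3.6) (`∫₀ᵗ∫_{B_{λᵐ}}|v_ε|² ≤ λ^{3m} t α̃_ε(t)`, accepted `setLIntegral_cylinder_enorm_sq_le_of_dss`,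
with `supBallEnergy_lt_top`), the other two by Cauchy–Schwarz against it. This is the a priori
finiteness that the printed "(3.7) … for any non-negative `φ`" presupposes for the approximants.
[cite: BradshawTsai2019, §3 (3.6)–(3.7) and the classes of G, π_ε (p. 9)] -/
theorem IsMollifiedApproximant.lintegral_energyRHS_lt_top (h : IsMollifiedApproximant c ε η v₀ w ϖ)
    (hc : 1 < c) (hη : ContDiff ℝ ∞ η) (hηc : HasCompactSupport η) (hε : 0 < ε)
    {ψ : (EuclideanSpace ℝ (Fin 3)) → ℝ} (hψ : ContDiff ℝ ∞ ψ) (hψc : HasCompactSupport ψ)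
    (hv₀ : AEStronglyMeasurable v₀ volume) (hfin : ∫⁻ x in ball (0 : (EuclideanSpace ℝ (Fin 3))) 1, ‖v₀ x‖ₑ ^ 2 < ⊤)
    (hG : ∀ t, 0 < t → ∫⁻ z in Ioo 0 t ×ˢ (univ : Set (EuclideanSpace ℝ (Fin 3))),
      ‖mollifiedDrift η ε w z.1 z.2‖ₑ ^ 2 * ‖w z.1 z.2‖ₑ ^ 2 < ⊤)
    (hP : ∀ t, 0 < t → ∫⁻ z in Ioo 0 t ×ˢ (univ : Set (EuclideanSpace ℝ (Fin 3))), ‖ϖ z.1 z.2‖ₑ ^ 2 < ⊤)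
    {t : ℝ} (ht : 0 < t) :
    ∫⁻ z in Ioo 0 t ×ˢ (univ : Set (EuclideanSpace ℝ (Fin 3))), (‖w z.1 z.2‖ₑ ^ 2 * ‖(Δ ψ) z.2‖ₑ + ‖w z.1 z.2‖ₑ ^ 2 * ‖mollifiedDrift η ε w z.1 z.2‖ₑ * ‖gradient ψ z.2‖ₑ + 2 * ‖ϖ z.1 z.2‖ₑ * ‖w z.1 z.2‖ₑ * ‖gradient ψ z.2‖ₑ) < ⊤ := by
  have hc0 : 0 < c := one_pos.trans hc
  set Q : Set (ℝ × (EuclideanSpace ℝ (Fin 3))) := Ioi (0 : ℝ) ×ˢ (univ : Set (EuclideanSpace ℝ (Fin 3))) with hQ_def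
  have cw : ContinuousOn (uncurry w) Q := h.smooth.continuousOn
  have cw' : ContinuousOn (fun z : ℝ × (EuclideanSpace ℝ (Fin 3)) => w z.1 z.2) Q := cw
  have cb : ContinuousOn (uncurry (mollifiedDrift η ε w)) Q :=
    h.continuousOn_mollifiedDrift hη.continuous hηc hε
  have cb' : ContinuousOn (fun z : ℝ × (EuclideanSpace ℝ (Fin 3)) => mollifiedDrift η ε w z.1 z.2) Q := cb
  have hψ2 : ContDiff ℝ 2 ψ := hψ.of_le (by norm_cast)
  have hψ1 : ContDiff ℝ 1 ψ := hψ2.of_le one_le_two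
  -- a ball `B = B_{λ^{m+1}}` containing the support of `ψ`
  obtain ⟨R, hR⟩ : ∃ R, tsupport ψ ⊆ ball (0 : (EuclideanSpace ℝ (Fin 3))) R := hψc.isCompact.isBounded.subset_ball 0
  obtain ⟨m, hm⟩ : ∃ m : ℕ, R < c ^ m := pow_unbounded_of_one_lt R hc
  have hcm : 1 < c ^ (m + 1) := one_lt_pow₀ hc (Nat.succ_ne_zero m)
  set B : Set (EuclideanSpace ℝ (Fin 3)) := ball (0 : (EuclideanSpace ℝ (Fin 3))) (c ^ (m + 1)) with hB
  have hψB : tsupport ψ ⊆ B :=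
    hR.trans (ball_subset_ball (hm.le.trans (pow_le_pow_right₀ hc.le (Nat.le_succ m))))
  set I : Set ℝ := Ioo (0 : ℝ) t with hI
  -- `∫∫_{(0,t)×B} |w|² < ∞` by (3.6) and the finiteness of `α̃`
  have hwB : ∫⁻ z in I ×ˢ B, ‖w z.1 z.2‖ₑ ^ 2 < ⊤ := by
    have key := setLIntegral_cylinder_enorm_sq_le_of_dss hcm (isDiscretelySelfSimilar_pow h.dss (m + 1)) ht
    refine key.trans_lt (ENNReal.mul_lt_top ENNReal.ofReal_lt_top ?_)
    calc ∫⁻ s in Ioo 0 t, supBallEnergy w s ≤ ∫⁻ s in Ioo 0 t, supBallEnergy w t :=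
          setLIntegral_mono' measurableSet_Ioo fun s hs => supBallEnergy_mono w hs.2.le
      _ = supBallEnergy w t * volume (Ioo (0 : ℝ) t) := setLIntegral_const _ _
      _ < ⊤ := ENNReal.mul_lt_top (h.supBallEnergy_lt_top hv₀ hfin ht)
          (by rw [Real.volume_Ioo]; exact ENNReal.ofReal_lt_top)
  -- bounds for `Δψ`, `∇ψ`
  have hΔc : Continuous (Δ ψ) := continuous_laplacian hψ2
  have hgc : Continuous (gradient ψ) := continuous_gradient_of_contDiff hψ1
  obtain ⟨MΔ, hMΔ⟩ := hψc.isCompact.exists_bound_of_continuousOn hΔc.continuousOn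
  obtain ⟨Mg, hMg⟩ := hψc.isCompact.exists_bound_of_continuousOn hgc.continuousOn
  have hΔ0 : ∀ x, x ∉ tsupport ψ → (Δ ψ) x = 0 := fun x hx => laplacian_eq_zero_of_notMem_tsupport hx
  have hg0 : ∀ x, x ∉ tsupport ψ → gradient ψ x = 0 := fun x hx => gradient_eq_zero_of_notMem_tsupport hx
  have eΔ : ∀ x, ‖(Δ ψ) x‖ₑ ≤ ENNReal.ofReal MΔ := fun x => by
    by_cases hx : x ∈ tsupport ψ
    · rw [← ofReal_norm]; exact ENNReal.ofReal_le_ofReal (hMΔ x hx)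
    · simp [hΔ0 x hx]
  have eg : ∀ x, ‖gradient ψ x‖ₑ ≤ ENNReal.ofReal Mg := fun x => by
    by_cases hx : x ∈ tsupport ψ
    · rw [← ofReal_norm]; exact ENNReal.ofReal_le_ofReal (hMg x hx)
    · simp [hg0 x hx]
  -- measurability on `(0,t) × B`
  set μ : Measure (ℝ × (EuclideanSpace ℝ (Fin 3))) := volume.restrict (I ×ˢ B) with hμ
  have mw : AEMeasurable (fun z : ℝ × (EuclideanSpace ℝ (Fin 3)) => ‖w z.1 z.2‖ₑ) μ :=
    (aestronglyMeasurable_restrict_of_continuousOn cw' t measurableSet_ball).enorm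
  have mb : AEMeasurable (fun z : ℝ × (EuclideanSpace ℝ (Fin 3)) => ‖mollifiedDrift η ε w z.1 z.2‖ₑ) μ :=
    (aestronglyMeasurable_restrict_of_continuousOn cb' t measurableSet_ball).enorm
  have mϖ : AEMeasurable (fun z : ℝ × (EuclideanSpace ℝ (Fin 3)) => ‖ϖ z.1 z.2‖ₑ) μ := by
    have h1 : AEStronglyMeasurable (uncurry ϖ) (volume.restrict Q) :=
      h.locallyIntegrableOn_pressure.aestronglyMeasurable
    exact (h1.mono_measure (Measure.restrict_mono (Set.prod_mono Ioo_subset_Ioi_self (subset_univ _))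
      le_rfl)).enorm
  have h22 : (2 : ℝ).HolderConjugate 2 := Real.holderConjugate_iff.2 ⟨by norm_num, by norm_num⟩
  -- the three Cauchy–Schwarz factors are finite
  have hA : (∫⁻ z, ‖w z.1 z.2‖ₑ ^ (2 : ℝ) ∂μ) ^ (1 / 2 : ℝ) < ⊤ := by
    refine ENNReal.rpow_lt_top_of_nonneg (by norm_num) (lt_top_iff_ne_top.1 ?_)
    simp only [ENNReal.rpow_two, hμ]
    exact hwB
  have hGB : (∫⁻ z, (‖mollifiedDrift η ε w z.1 z.2‖ₑ * ‖w z.1 z.2‖ₑ) ^ (2 : ℝ) ∂μ) ^ (1 / 2 : ℝ) < ⊤ := by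
    refine ENNReal.rpow_lt_top_of_nonneg (by norm_num) (lt_top_iff_ne_top.1 ?_)
    simp only [ENNReal.rpow_two, hμ, mul_pow]
    exact (lintegral_mono_set (prod_mono subset_rfl (subset_univ _))).trans_lt (hG t ht)
  have hPB : (∫⁻ z, ‖ϖ z.1 z.2‖ₑ ^ (2 : ℝ) ∂μ) ^ (1 / 2 : ℝ) < ⊤ := by
    refine ENNReal.rpow_lt_top_of_nonneg (by norm_num) (lt_top_iff_ne_top.1 ?_)
    simp only [ENNReal.rpow_two, hμ]
    exact (lintegral_mono_set (prod_mono subset_rfl (subset_univ _))).trans_lt (hP t ht)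
  -- the dominating density on `(0,t) × B`
  set G : ℝ × (EuclideanSpace ℝ (Fin 3)) → ℝ≥0∞ := fun z => ENNReal.ofReal MΔ * ‖w z.1 z.2‖ₑ ^ 2 +
    ENNReal.ofReal Mg * (‖w z.1 z.2‖ₑ * (‖mollifiedDrift η ε w z.1 z.2‖ₑ * ‖w z.1 z.2‖ₑ)) +
    2 * ENNReal.ofReal Mg * (‖w z.1 z.2‖ₑ * ‖ϖ z.1 z.2‖ₑ) with hGdef
  have hle : ∀ z ∈ I ×ˢ B, (‖w z.1 z.2‖ₑ ^ 2 * ‖(Δ ψ) z.2‖ₑ + ‖w z.1 z.2‖ₑ ^ 2 * ‖mollifiedDrift η ε w z.1 z.2‖ₑ * ‖gradient ψ z.2‖ₑ + 2 * ‖ϖ z.1 z.2‖ₑ * ‖w z.1 z.2‖ₑ * ‖gradient ψ z.2‖ₑ) ≤ G z := by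
    intro z _
    simp only [hGdef]
    refine add_le_add (add_le_add ?_ ?_) ?_
    · rw [mul_comm]; exact mul_le_mul' (eΔ _) le_rfl
    · calc ‖w z.1 z.2‖ₑ ^ 2 * ‖mollifiedDrift η ε w z.1 z.2‖ₑ * ‖gradient ψ z.2‖ₑ
          ≤ ‖w z.1 z.2‖ₑ ^ 2 * ‖mollifiedDrift η ε w z.1 z.2‖ₑ * ENNReal.ofReal Mg :=
            mul_le_mul' le_rfl (eg _)
        _ = ENNReal.ofReal Mg * (‖w z.1 z.2‖ₑ * (‖mollifiedDrift η ε w z.1 z.2‖ₑ * ‖w z.1 z.2‖ₑ)) := by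
            ring
    · calc 2 * ‖ϖ z.1 z.2‖ₑ * ‖w z.1 z.2‖ₑ * ‖gradient ψ z.2‖ₑ
          ≤ 2 * ‖ϖ z.1 z.2‖ₑ * ‖w z.1 z.2‖ₑ * ENNReal.ofReal Mg := mul_le_mul' le_rfl (eg _)
        _ = 2 * ENNReal.ofReal Mg * (‖w z.1 z.2‖ₑ * ‖ϖ z.1 z.2‖ₑ) := by ring
  have h0 : ∀ z ∈ I ×ˢ Bᶜ, (‖w z.1 z.2‖ₑ ^ 2 * ‖(Δ ψ) z.2‖ₑ + ‖w z.1 z.2‖ₑ ^ 2 * ‖mollifiedDrift η ε w z.1 z.2‖ₑ * ‖gradient ψ z.2‖ₑ + 2 * ‖ϖ z.1 z.2‖ₑ * ‖w z.1 z.2‖ₑ * ‖gradient ψ z.2‖ₑ) = 0 := by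
    intro z hz
    have hx : z.2 ∉ tsupport ψ := fun h' => hz.2 (hψB h')
    simp [hΔ0 _ hx, hg0 _ hx]
  -- integrate
  have m1 : AEMeasurable (fun z : ℝ × (EuclideanSpace ℝ (Fin 3)) => ENNReal.ofReal MΔ * ‖w z.1 z.2‖ₑ ^ 2) μ :=
    (mw.pow_const 2).const_mul _
  have m2 : AEMeasurable (fun z : ℝ × (EuclideanSpace ℝ (Fin 3)) =>
      ENNReal.ofReal Mg * (‖w z.1 z.2‖ₑ * (‖mollifiedDrift η ε w z.1 z.2‖ₑ * ‖w z.1 z.2‖ₑ))) μ :=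
    (mw.mul (mb.mul mw)).const_mul _
  calc ∫⁻ z in Ioo 0 t ×ˢ (univ : Set (EuclideanSpace ℝ (Fin 3))), (‖w z.1 z.2‖ₑ ^ 2 * ‖(Δ ψ) z.2‖ₑ + ‖w z.1 z.2‖ₑ ^ 2 * ‖mollifiedDrift η ε w z.1 z.2‖ₑ * ‖gradient ψ z.2‖ₑ + 2 * ‖ϖ z.1 z.2‖ₑ * ‖w z.1 z.2‖ₑ * ‖gradient ψ z.2‖ₑ)
      ≤ ∫⁻ z in I ×ˢ B, G z := setLIntegral_prod_univ_le_of_eq_zero_off measurableSet_Ioo measurableSet_ball hle h0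
    _ = (∫⁻ z, ENNReal.ofReal MΔ * ‖w z.1 z.2‖ₑ ^ 2 ∂μ) +
          (∫⁻ z, ENNReal.ofReal Mg * (‖w z.1 z.2‖ₑ * (‖mollifiedDrift η ε w z.1 z.2‖ₑ * ‖w z.1 z.2‖ₑ)) ∂μ) +
          ∫⁻ z, 2 * ENNReal.ofReal Mg * (‖w z.1 z.2‖ₑ * ‖ϖ z.1 z.2‖ₑ) ∂μ := by
        have m12 : AEMeasurable (fun z : ℝ × (EuclideanSpace ℝ (Fin 3)) => ENNReal.ofReal MΔ * ‖w z.1 z.2‖ₑ ^ 2 +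
            ENNReal.ofReal Mg * (‖w z.1 z.2‖ₑ * (‖mollifiedDrift η ε w z.1 z.2‖ₑ * ‖w z.1 z.2‖ₑ))) μ :=
          m1.add m2
        rw [hμ, ← lintegral_add_left' m1, ← lintegral_add_left' m12]
    _ < ⊤ := by
        refine ENNReal.add_lt_top.2 ⟨ENNReal.add_lt_top.2 ⟨?_, ?_⟩, ?_⟩
        · rw [lintegral_const_mul' _ _ ENNReal.ofReal_ne_top]
          refine ENNReal.mul_lt_top ENNReal.ofReal_lt_top ?_
          rw [hμ]; exact hwB
        · rw [lintegral_const_mul' _ _ ENNReal.ofReal_ne_top]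
          refine ENNReal.mul_lt_top ENNReal.ofReal_lt_top ?_
          have hH := ENNReal.lintegral_mul_le_Lp_mul_Lq μ h22 mw (mb.mul mw)
          simp only [Pi.mul_apply] at hH
          exact hH.trans_lt (ENNReal.mul_lt_top hA hGB)
        · rw [lintegral_const_mul' _ _ (ENNReal.mul_ne_top (by norm_num) ENNReal.ofReal_ne_top)]
          refine ENNReal.mul_lt_top (ENNReal.mul_lt_top (by norm_num) ENNReal.ofReal_lt_top) ?_
          have hH := ENNReal.lintegral_mul_le_Lp_mul_Lq μ h22 mw mϖ
          simp only [Pi.mul_apply] at hH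
          exact hH.trans_lt (ENNReal.mul_lt_top hA hPB)

/-- **The dissipation of a member is finite down to `t = 0`** under the hypotheses of
`lintegral_energyRHS_lt_top` and for `ψ ≥ 0` with `∫|v₀|²ψ < ∞`: `∫₀ᵗ∫ ψ|∇v_ε|² < ∞` — the
finiteness that the absorption step of (3.12) ("the gradient term can be absorbed into the left
hand side of (3.7)", p. 9) requires. [cite: BradshawTsai2019, §3 (3.7), p. 9 (absorption)] -/
theorem IsMollifiedApproximant.lintegral_dissipation_lt_top (h : IsMollifiedApproximant c ε η v₀ w ϖ)
    (hc : 1 < c) (hη : ContDiff ℝ ∞ η) (hηc : HasCompactSupport η) (hε : 0 < ε)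
    {ψ : (EuclideanSpace ℝ (Fin 3)) → ℝ} (hψ : ContDiff ℝ ∞ ψ) (hψc : HasCompactSupport ψ) (hψ0 : ∀ x, 0 ≤ ψ x)
    (hv₀ : AEStronglyMeasurable v₀ volume) (hfin : ∫⁻ x in ball (0 : (EuclideanSpace ℝ (Fin 3))) 1, ‖v₀ x‖ₑ ^ 2 < ⊤)
    (hv₀ψ : ∫⁻ x, ‖v₀ x‖ₑ ^ 2 * ENNReal.ofReal (ψ x) < ⊤)
    (hG : ∀ t, 0 < t → ∫⁻ z in Ioo 0 t ×ˢ (univ : Set (EuclideanSpace ℝ (Fin 3))),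
      ‖mollifiedDrift η ε w z.1 z.2‖ₑ ^ 2 * ‖w z.1 z.2‖ₑ ^ 2 < ⊤)
    (hP : ∀ t, 0 < t → ∫⁻ z in Ioo 0 t ×ˢ (univ : Set (EuclideanSpace ℝ (Fin 3))), ‖ϖ z.1 z.2‖ₑ ^ 2 < ⊤)
    {t : ℝ} (ht : 0 < t) :
    ∫⁻ z in Ioo 0 t ×ˢ (univ : Set (EuclideanSpace ℝ (Fin 3))),
      ENNReal.ofReal (ψ z.2 * frobeniusNormSq (fderiv ℝ (w z.1) z.2)) < ⊤ := by
  have key := h.energy_ineq_zero hη hηc hε hψ hψc hψ0 hv₀ hv₀ψ ht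
  have hR := h.lintegral_energyRHS_lt_top hc hη hηc hε hψ hψc hv₀ hfin hG hP ht
  have h2 : 2 * ∫⁻ z in Ioo 0 t ×ˢ (univ : Set (EuclideanSpace ℝ (Fin 3))),
      ENNReal.ofReal (ψ z.2 * frobeniusNormSq (fderiv ℝ (w z.1) z.2)) < ⊤ :=
    lt_of_le_of_lt (le_add_self.trans key) (ENNReal.add_lt_top.2 ⟨hv₀ψ, hR⟩)
  exact lt_of_le_of_lt (le_mul_of_one_le_left' one_le_two) h2

end Members

end BradshawTsai2019

end Literature.Analysis.FluidPDE

end
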